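import Literature.Topology.FourManifolds.LatticeFormsPolarisationTypesGeneralDivisor
import HarnessLib

/-!
# Polarisation types up to the FULL orthogonal group: for `w = 1` all primitive `h_d ∈ L_{2t} = B₀ ⊕ ⟨−2t⟩` with
# `h_d² = 2d`, `div(h_d) = f` lie in ONE `O(L_{2t})`-orbit
# (Gritsenko–Hulek–Sankaran, *Compositio Math.* 146 (2010), §4 Cor. 4.7, with the two facts of its proof:
# `A_{L_{2t}}` is cyclic with `O(A_{L_{2t}}, q) = {x mod 2t : x² ≡ 1 (mod 4t)}`, and `O(L_{2t}) ↠ O(A_{L_{2t}}, q)`)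

Trunk T-4MAN vocabulary; sequel of `LatticeFormsPolarisationTypesGeneralDivisor.lean` (row g43-#2: Prop. 4.6 — a primitive
`h = fv + cl_t` with `(h, L) = fℤ` has `(c, f) = 1`, `f² ∣ d + c²t`, and its `Õ(L)`-orbit is the class `c mod f`), of
`LatticeFormsNegTwoDVectorOrbitCount.lean` (the Eichler criterion with divisor
`exists_stable_isometryEquiv_apply_eq_iff_dvd_snd_sub_snd`, and `Õ` fixes `l* + L`), of
`LatticeFormsDiscriminantFormLifting.lean` (Nikulin's lifting `O(Λ) ↠ O(A_Λ, q_Λ)` for a lattice with a hyperbolic pair,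
`exists_isometryEquiv_discriminantGroupCongr_eq_of_hyperbolic_pair`) and of `LatticeFormsRankOneDiscriminantFormIsometries.lean`
(g39: `O(ℤ/2n, q_{2n}) = {u mod 2n : u² ≡ 1 (mod 4n)}` for the rank-one lattice — the same computation is redone here
inside `B₀ ⊕ ⟨−2t⟩`, whose discriminant group is generated by the class of `l_t^* = l_t/2t`). Written for lane
`lit-hodgefound` (Track 2 foundations; prover seat `lit-hodgefound-p18`, gen 44, row g44-#1). THEOREMS ONLY — no
definition, no named fact, no instance, no notation.

## Source, verbatim (V. Gritsenko, K. Hulek, G. K. Sankaran, Compositio Math. 146 (2010) 404–434, arXiv numbering §4,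
held text `paper:arxiv-0802.2078` pp. 10–11)

"**Proposition 4.6.** Let `h_d ∈ L_{2t}` be primitive of length `2d > 0` and `div(h_d) = f`. We put
`g = (2t/f, 2d/f)`, `w = (g, f)`, `g = wg₁`, `f = wf₁`. […] *Proof.* A primitive vector `h_d` with `(h_d, L_{2t}) = fℤ`
can be written `h_d = fv + cl_t` where `v ∈ 3U ⊕ 2E₈(−1)`. The coefficient `c` is coprime to `f` because `h_d` is
primitive. According to Eichler's criterion (Lemma 4.5) the `Õ(L_{2t})`-orbit of `h_d` is uniquely determined by
`h_d^* ≡ (c/f) l_t mod L_{2t}`. Therefore it is determined by `c mod f` because the discriminant group of `L_{2t}` is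
cyclic. We put `v² = 2b`. Then `2d = 2bf² − 2c²t` […]
**Corollary 4.7.** Let us assume that `w = 1`. If there exists a primitive vector `h_d ∈ L_{2t}` such that `h_d² = 2d`
and `div(h_d) = f`, then all such vectors belong to the same `O(L_{2t})`-orbit.
*Proof.* The natural projection `O(L_{2t}) → O(D(L_{2t}))` is surjective (see [Nik]). Furthermore (see [GH])
`O(D(L_{2t})) ≅ {x mod 2t ∣ x² ≡ 1 mod 4t}`. Therefore for `w = 1` all solutions `c mod f` of the congruences
(c1-cong0) and (c1-cong1-1) are equivalent modulo the action of this abelian `2`-group. □"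
Also Remark 4.14: "The condition `w = 1`, i.e., that `f` and `(2t/f, 2d/f)` are coprime, is valid for any `f` if `(2t, 2d)`
is square free. In particular this condition is true for any vector `h_d` if `2t` is square free."

## Reading notes

* ABSTRACTION as in g41–g43: everything is proved for `L = B₀ ⊕ ⟨−2t⟩` on `M × ℤ` (`B₀.prod ((-(2t)) • mul)`), `B₀`
  symmetric even unimodular with two orthogonal hyperbolic pairs (`L_{2t}`: `B₀ = 3U ⊕ 2E₈(−1)`; `Kumⁿ`: `B₀ = 3U`), then
  specialised to the models `(E₈(−1)^{⊕m} ⊕ U^{⊕(k+2)}) ⊕ ℤ(−2t)` (§7). "`div(h_d) = f`" is "`f ∣ (h, z)` for all `z` and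
  `(h, h') = f` for some `h'`"; "primitive" is "`h ≠ 0` and `ℤh` saturated"; the `l_t`-coordinate `c` of `h` is `h.2`.
* THE ARITHMETIC OF `w = 1` ("all solutions `c mod f` … are equivalent modulo the action of this abelian `2`-group"),
  spelled out (§5): from `f² ∣ d + c²t` one gets `f ∣ 2d/f + (2t/f)c²`, hence `(f, 2t/f) ∣ w`; so `w = 1` forces
  `(f, 2t/f) = 1` (conversely `(f, 2t/f) = 1 ⟹ w = 1` trivially), and then for two admissible `c, c'` (coprime to `f`,
  `f² ∣ d + c²t`, `f² ∣ d + c'²t`) there is `s` with `s² ≡ 1 (mod 4t)` and `sc ≡ c' (mod f)`: with `F = f` or `2f`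
  according as `f` is odd or even and `N = 4t/F` one has `(F, N) = 1`, `F ∣ c'² − c²`, `(c, F) = 1`; take
  `s ≡ c'/c (mod F)`, `s ≡ 1 (mod N)` (Chinese remainder theorem).
* THE ORBIT (§6): `x ↦ sx` is an isometry of `(A_L, q_L) ≅ (ℤ/2t, −x²/2t)` (§2), lifts to some `g ∈ O(L)` (§3, the tree's
  Nikulin lifting, here through the hyperbolic pair `(x, 0), (y, 0)` of `L`), `(gh).l_t ≡ s·h.l_t ≡ h'.l_t (mod f)` (§4), so
  `gh` and `h'` have the same Eichler invariants and an `Õ(L)`-word finishes. As printed, `2d > 0` is not used and dropped.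
* `O(D(L_{2t})) ≅ {x mod 2t ∣ x² ≡ 1 mod 4t}` is rendered as: every additive endomorphism of `A_L` is a homothety `x ↦ sx`
  (§1), `x ↦ sx` preserves `q_L` iff `4t ∣ s² − 1` (§2), every such `s` is induced by `O(L)` and every `ḡ`, `g ∈ O(L)`, is
  such an `s` (§3); two homotheties agree iff `s ≡ s' (mod 2t)` (§1). No group structure on `O(A_L, q_L)` is declared.

## Contents (all proved; `L = B₀.prod ((-(2 * t : ℤ)) • LinearMap.mul ℤ ℤ)`, `γ = [l_t^*]` the class of the functional
`LinearMap.snd ℤ M ℤ`)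

* §1 `A_L` is cyclic (`B₀` unimodular): `prod_neg_twoMul_smul_mul_zero_neg_one` (`i_L(−l_t) = 2t·l_t^*`),
  **`mk_eq_zsmul_mk_snd`** (`[φ] = φ(l_t)·γ`), `two_mul_zsmul_mk_snd_eq_zero` (`2t·γ = 0`), `two_mul_zsmul_eq_zero`,
  `zsmul_mk_snd_eq_zero_iff` (`m·γ = 0 ⟺ 2t ∣ m`), `forall_zsmul_eq_zsmul_iff_prod_neg_twoMul` (`s ≡ s' (mod 2t)`),
  **`exists_int_forall_apply_eq_zsmul_prod_neg_twoMul`** (every additive endomorphism of `A_L` is `x ↦ sx`).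
* §2 `q_L`: **`discriminantQuad_mk_snd`** (`q_L(γ) = −1/2t`), `discriminantQuad_zsmul_mk_snd` (`q_L(mγ) = −m²/2t`),
  **`forall_discriminantQuad_zsmul_iff_prod_neg_twoMul`** (`x ↦ sx` preserves `q_L` iff `4t ∣ s² − 1`), `zsmul_zsmul_eq_self_prod_neg_twoMul`.
* §3 **`exists_isometryEquiv_discriminantGroupCongr_eq_zsmul`** (`4t ∣ s² − 1 ⟹ ∃ g ∈ O(L), ḡ = s·`; Nikulin) and
  **`exists_int_discriminantGroupCongr_eq_zsmul`** (every `g ∈ O(L)` has `ḡ = s·` with `4t ∣ s² − 1`).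
* §4 `exists_smul_eq_apply_sub_zsmul_of_discriminantGroupCongr_eq_zsmul` (`ḡ = s· ⟹ gl ≡ sl (mod δL)` whenever
  `δ ∣ (l, L)`; any nondegenerate lattice), `dvd_snd_apply_sub_mul_snd_of_discriminantGroupCongr_eq_zsmul`
  (`(gh).l_t ≡ s·h.l_t (mod δ)` in `B₀ ⊕ ⟨−2t⟩`).
* §5 arithmetic: `exists_sq_sub_one_dvd_of_isCoprime` (CRT core), `dvd_add_mul_sq_of_sq_dvd` (`f ∣ 2d/f + (2t/f)c²`),
  **`gcd_eq_one_of_w_eq_one`** (`w = 1 ⟹ (f, 2t/f) = 1`), `w_eq_one_of_gcd_eq_one` (the converse),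
  **`exists_four_mul_dvd_sq_sub_one_and_dvd`** (`(f, 2t/f) = 1`, `c, c'` admissible ⟹ `∃ s`, `4t ∣ s² − 1`, `f ∣ sc − c'`).
* §6 **Cor. 4.7**: `exists_isometryEquiv_apply_eq_of_divisor_of_gcd_eq_one` (hypothesis `(f, 2t/f) = 1`),
  **`exists_isometryEquiv_apply_eq_of_divisor_of_w_eq_one`** (hypothesis `w = ((2t/f, 2d/f), f) = 1`, as printed),
  `exists_isometryEquiv_apply_eq_of_divisor_of_squarefree` (Remark 4.14: `2t` squarefree), and the count
  **`natCard_quot_isometryEquiv_two_mul_of_divisor_of_w_eq_one`** (exactly one `O(L)`-orbit as soon as one such vector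
  exists) — to be contrasted with the `Õ(L)`-count `#{c mod f admissible}` of `LatticeFormsPolarisationTypesGeneralDivisor`.
* §7 the models `(E₈(−1)^{⊕m} ⊕ U^{⊕(k+2)}) ⊕ ℤ(−2t)`: `exists_isometryEquiv_model_apply_eq_of_divisor_of_w_eq_one`,
  `natCard_quot_isometryEquiv_model_two_mul_of_divisor_of_w_eq_one`.
* §8 (appended, row g44-#5) the `O(L)`-orbits WITHOUT the hypothesis `w = 1`, as the printed proof gives them: two vectors
  `h, h'` with `h² = h'² = 2d`, `(h, L) = (h', L) = fℤ` are `O(L)`-equivalent **iff** `c' ≡ σc (mod f)` for some `σ` with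
  `σ² ≡ 1 (mod 4t)` (`exists_isometryEquiv_apply_eq_iff_exists_sq_sub_one_dvd`), so that the `O(L)`-orbits of primitive such
  vectors are in bijection with the admissible classes `c mod f` modulo the action of `{σ mod 2t : σ² ≡ 1 (mod 4t)}`
  (**`natCard_quot_isometryEquiv_two_mul_of_divisor`**; models: `…_model_…`).

## Added in row g45-#10 (§9)

* **`exists_isometryEquiv_apply_eq_iff_dvd_sub_or_dvd_add`** (orbits of `{g ∈ O(L) : ḡ = ±id}`: `h ∼ h₁` iff `c₁ ≡ ±c (mod f)`),
  **`natCard_quot_isometryEquiv_discriminantGroupCongr_eq_self_or_neg_two_mul_of_divisor`** (their number = admissible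
  classes up to sign), and the model versions `exists_isometryEquiv_model_apply_eq_iff_dvd_sub_or_dvd_add`,
  `natCard_quot_isometryEquiv_discriminantGroupCongr_eq_self_or_neg_model_two_mul_of_divisor`.

## References

* [GritsenkoHulekSankaran2010Symplectic] V. Gritsenko, K. Hulek, G. K. Sankaran, Moduli spaces of irreducible symplectic
  manifolds, Compositio Math. 146 (2010) 404–434 (arXiv:0802.2078): §4 Cor. 4.7 and its proof, Prop. 4.6 (proof, first
  paragraph), Lemma 4.5, Remark 4.14.
* [GritsenkoHulek1998] V. Gritsenko, K. Hulek, Minimal Siegel modular threefolds, Math. Proc. Cambridge Philos. Soc. 123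
  (1998) 461–485 — GHS's "[GH]" for `O(D(L_{2t})) ≅ {x mod 2t ∣ x² ≡ 1 mod 4t}` (cited through GHS 2010).
* [Nikulin1980] V. V. Nikulin, Integral symmetric bilinear forms and some of their applications, Math. USSR Izv. 14
  (1980) 103–167: Thm. 1.14.2 (`O(L) ↠ O(q_L)`), §1.3 — GHS's "[Nik]" (in the tree via Huybrechts, Ch. 14 Thm. 2.4).
* [GritsenkoHulekSankaran2009] V. Gritsenko, K. Hulek, G. K. Sankaran, Abelianisation of orthogonal groups and the
  fundamental group of modular varieties, J. Algebra 322 (2009): Prop. 3.3 (i) (Eichler criterion).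
* [Huybrechts2016K3] D. Huybrechts, Lectures on K3 Surfaces, CUP 2016: Ch. 14 §0.1 (`A_Λ`, `q_Λ`), Thm. 2.4.
* [Markman2011Survey] E. Markman, A survey of Torelli and monodromy results for holomorphic-symplectic varieties, in:
  Complex and Differential Geometry, Springer Proc. Math. 8 (2011): §9.1.1 Lemma 9.2 (`Mon²(K3^{[n]}) = π⁻¹{1, −1}`) — the
  group whose orbits §9 computes (without the orientation character).
-/

noncomputable section

open Module Function
open LinearMap (BilinForm)
open LinearMap.BilinForm

namespace Literature.Topology.FourManifolds

universe u

/-! ### §1 `A_{B₀ ⊕ ⟨−2t⟩}` is cyclic, generated by `γ = [l_t^*]`; its endomorphisms are the homotheties -/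

section Cyclic

variable {M : Type u} [AddCommGroup M] {B₀ : BilinForm ℤ M} (t : ℕ)

/-- **`i_L(−l_t) = 2t · l_t^*`**: the functional `(−l_t, ·)` of `L = B₀ ⊕ ⟨−2t⟩` is `2t` times the coordinate
functional `l_t^* : (v, c) ↦ c` (so `l_t^* = −l_t/2t ∈ L^∨`, and `[l_t^*] = −[l_t/2t]` generates `D(L_{2t})`).
[cite: GritsenkoHulekSankaran2010Symplectic, §4 proof of Prop. 4.6 ("`h_d^* ≡ (c/f) l_t mod L_{2t}` … the discriminant group of `L_{2t}` is cyclic")] -/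
theorem prod_neg_twoMul_smul_mul_zero_neg_one :
    B₀.prod ((-(2 * t : ℤ)) • LinearMap.mul ℤ ℤ) ((0 : M), (-1 : ℤ)) = (2 * t : ℤ) • LinearMap.snd ℤ M ℤ := by
  refine LinearMap.ext fun p ↦ ?_
  simp only [prod_neg_twoMul_smul_mul_apply, map_zero, LinearMap.zero_apply, LinearMap.smul_apply,
    LinearMap.snd_apply, smul_eq_mul]
  ring

/-- **"The discriminant group of `L_{2t}` is cyclic"**: in `A_L`, `L = B₀ ⊕ ⟨−2t⟩` with `B₀` unimodular, every class
is a multiple of `γ = [l_t^*]`, namely `[φ] = φ(l_t) · γ` (the `B₀`-part of `φ` is `(u, ·)` for some `u ∈ B₀`).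
[cite: GritsenkoHulekSankaran2010Symplectic, §4 proof of Prop. 4.6 ("the discriminant group of `L_{2t}` is cyclic")] [cite: Huybrechts2016K3, Ch. 14 §0.1] -/
theorem mk_eq_zsmul_mk_snd (hu : B₀.IsUnimodular) (φ : Module.Dual ℤ (M × ℤ)) :
    (Submodule.Quotient.mk φ : (B₀.prod ((-(2 * t : ℤ)) • LinearMap.mul ℤ ℤ)).discriminantGroup) =
      φ ((0 : M), (1 : ℤ)) • Submodule.Quotient.mk (LinearMap.snd ℤ M ℤ) := by
  haveI : B₀.IsPerfPair := hu
  obtain ⟨u, hu'⟩ := (LinearMap.IsPerfPair.bijective_left B₀).2 (φ ∘ₗ LinearMap.inl ℤ M ℤ)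
  have key : φ = (B₀.prod ((-(2 * t : ℤ)) • LinearMap.mul ℤ ℤ)) (u, 0) + φ ((0 : M), (1 : ℤ)) • LinearMap.snd ℤ M ℤ := by
    refine LinearMap.ext fun p ↦ ?_
    have hp : p = (p.1, (0 : ℤ)) + p.2 • ((0 : M), (1 : ℤ)) := by ext <;> simp
    have h1 : φ (p.1, (0 : ℤ)) = B₀ u p.1 := by
      rw [hu', LinearMap.comp_apply, LinearMap.inl_apply]
    conv_lhs => rw [hp]
    rw [map_add, map_smul, h1, LinearMap.add_apply, LinearMap.smul_apply, LinearMap.snd_apply,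
      prod_neg_twoMul_smul_mul_apply, smul_eq_mul, smul_eq_mul]
    dsimp only
    ring
  have hmk : (Submodule.Quotient.mk φ : (B₀.prod ((-(2 * t : ℤ)) • LinearMap.mul ℤ ℤ)).discriminantGroup) =
      Submodule.Quotient.mk ((B₀.prod ((-(2 * t : ℤ)) • LinearMap.mul ℤ ℤ)) (u, 0)) +
        Submodule.Quotient.mk (φ ((0 : M), (1 : ℤ)) • LinearMap.snd ℤ M ℤ) := by
    rw [← Submodule.Quotient.mk_add, ← key]
  rw [hmk, discriminantGroup_mk_apply, zero_add]
  rfl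

/-- `2t · γ = 0` in `A_L` (`2t · l_t^* = i_L(−l_t)`): the generator has order dividing `2t = |D(L_{2t})|`.
[cite: GritsenkoHulekSankaran2010Symplectic, §4 ("`2t = −det(L_{2t})`")] -/
theorem two_mul_zsmul_mk_snd_eq_zero :
    ((2 * t : ℤ) • Submodule.Quotient.mk (LinearMap.snd ℤ M ℤ) :
      (B₀.prod ((-(2 * t : ℤ)) • LinearMap.mul ℤ ℤ)).discriminantGroup) = 0 := by
  have h : ((2 * t : ℤ) • Submodule.Quotient.mk (LinearMap.snd ℤ M ℤ) :
      (B₀.prod ((-(2 * t : ℤ)) • LinearMap.mul ℤ ℤ)).discriminantGroup) =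
        Submodule.Quotient.mk ((2 * t : ℤ) • LinearMap.snd ℤ M ℤ) := rfl
  rw [h, ← prod_neg_twoMul_smul_mul_zero_neg_one (B₀ := B₀) t, discriminantGroup_mk_apply]

/-- `2t · a = 0` for every `a ∈ A_L` (`B₀` unimodular): `A_L` has exponent dividing `2t`.
[cite: GritsenkoHulekSankaran2010Symplectic, §4 proof of Prop. 4.6 ("the discriminant group of `L_{2t}` is cyclic")] -/
theorem two_mul_zsmul_eq_zero (hu : B₀.IsUnimodular)
    (a : (B₀.prod ((-(2 * t : ℤ)) • LinearMap.mul ℤ ℤ)).discriminantGroup) : (2 * t : ℤ) • a = 0 := by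
  obtain ⟨φ, rfl⟩ := Submodule.Quotient.mk_surjective _ a
  rw [mk_eq_zsmul_mk_snd t hu φ, smul_comm, two_mul_zsmul_mk_snd_eq_zero]
  exact smul_zero _

/-- **`m · γ = 0 ⟺ 2t ∣ m`**: the generator `γ = [l_t^*]` of `A_L` has order exactly `2t` (`B₀` unimodular, `t ≥ 1`;
`m · l_t^* ∈ i_L(L)` forces `m = (w, l_t)·(−1)… ∈ 2tℤ` by evaluating at `l_t`). So `A_L ≅ ℤ/2t`.
[cite: GritsenkoHulekSankaran2010Symplectic, §4 proof of Cor. 4.7 ("`x mod 2t`")] [cite: Huybrechts2016K3, Ch. 14 §0.1 ("a finite group of order `|disc Λ|`")] -/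
theorem zsmul_mk_snd_eq_zero_iff (m : ℤ) :
    ((m • Submodule.Quotient.mk (LinearMap.snd ℤ M ℤ) :
      (B₀.prod ((-(2 * t : ℤ)) • LinearMap.mul ℤ ℤ)).discriminantGroup) = 0) ↔ (2 * t : ℤ) ∣ m := by
  have h : ((m • Submodule.Quotient.mk (LinearMap.snd ℤ M ℤ) :
      (B₀.prod ((-(2 * t : ℤ)) • LinearMap.mul ℤ ℤ)).discriminantGroup)) =
        Submodule.Quotient.mk (m • LinearMap.snd ℤ M ℤ) := rfl
  rw [h, Submodule.Quotient.mk_eq_zero, LinearMap.mem_range]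
  constructor
  · rintro ⟨w, hw⟩
    have h1 := LinearMap.congr_fun hw ((0 : M), (1 : ℤ))
    rw [prod_neg_twoMul_smul_mul_apply, LinearMap.smul_apply, LinearMap.snd_apply, smul_eq_mul] at h1
    dsimp only at h1
    rw [map_zero, mul_one, mul_one, zero_sub] at h1
    exact ⟨-w.2, by linarith⟩
  · rintro ⟨k, rfl⟩
    refine ⟨((0 : M), -k), LinearMap.ext fun p ↦ ?_⟩
    simp only [prod_neg_twoMul_smul_mul_apply, map_zero, LinearMap.zero_apply, LinearMap.smul_apply,
      LinearMap.snd_apply, smul_eq_mul]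
    ring

/-- Two homotheties `x ↦ sx`, `x ↦ s'x` of `A_L` agree iff `s ≡ s' (mod 2t)` — the isometries of `D(L_{2t})` are
residues "`x mod 2t`". (`B₀` unimodular.) [cite: GritsenkoHulekSankaran2010Symplectic, §4 proof of Cor. 4.7] -/
theorem forall_zsmul_eq_zsmul_iff_prod_neg_twoMul (hu : B₀.IsUnimodular) (s s' : ℤ) :
    (∀ a : (B₀.prod ((-(2 * t : ℤ)) • LinearMap.mul ℤ ℤ)).discriminantGroup, s • a = s' • a) ↔ (2 * t : ℤ) ∣ s - s' := by
  constructor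
  · intro h
    have h1 := h (Submodule.Quotient.mk (LinearMap.snd ℤ M ℤ))
    rw [← sub_eq_zero, ← sub_smul] at h1
    exact (zsmul_mk_snd_eq_zero_iff t (s - s')).1 h1
  · rintro ⟨k, hk⟩ a
    rw [← sub_eq_zero, ← sub_smul, hk, mul_smul]
    exact two_mul_zsmul_eq_zero t hu _

/-- **Every additive endomorphism of the cyclic group `A_L` is a homothety `x ↦ sx`** (`s = ` the coefficient of the
image of the generator `γ`) — so the isometries of `D(L_{2t})` form a set of residues `x mod 2t`. (`B₀` unimodular.)
[cite: GritsenkoHulekSankaran2010Symplectic, §4 proof of Cor. 4.7 ("`O(D(L_{2t})) ≅ {x mod 2t ∣ x² ≡ 1 mod 4t}`")] -/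
theorem exists_int_forall_apply_eq_zsmul_prod_neg_twoMul (hu : B₀.IsUnimodular)
    (δ : (B₀.prod ((-(2 * t : ℤ)) • LinearMap.mul ℤ ℤ)).discriminantGroup →+
      (B₀.prod ((-(2 * t : ℤ)) • LinearMap.mul ℤ ℤ)).discriminantGroup) :
    ∃ s : ℤ, ∀ a, δ a = s • a := by
  obtain ⟨ψ, hψ⟩ := Submodule.Quotient.mk_surjective _ (δ (Submodule.Quotient.mk (LinearMap.snd ℤ M ℤ)))
  refine ⟨ψ ((0 : M), (1 : ℤ)), fun a ↦ ?_⟩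
  obtain ⟨φ, rfl⟩ := Submodule.Quotient.mk_surjective _ a
  rw [mk_eq_zsmul_mk_snd t hu φ, map_zsmul, ← hψ, mk_eq_zsmul_mk_snd t hu ψ, smul_comm]

end Cyclic

/-! ### §2 `q_L(γ) = −1/2t`, and `x ↦ sx` preserves `q_L` iff `s² ≡ 1 (mod 4t)` -/

section Quad

variable {M : Type u} [AddCommGroup M] [Module.Finite ℤ M] [Module.Free ℤ M] {B₀ : BilinForm ℤ M} (t : ℕ)

/-- **`q_L(γ) = −1/2t mod 2ℤ`** for the generator `γ = [l_t^*]` of `A_L` (`l_t^* = −l_t/2t`, `(l_t^*)² = l_t²/4t² = −1/2t`):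
the discriminant form of `L_{2t}` is `(ℤ/2t, x ↦ −x²/2t)`. (`t ≥ 1`; `L` nondegenerate symmetric even.)
[cite: GritsenkoHulekSankaran2010Symplectic, §4 proof of Cor. 4.7 and proof of Prop. 4.12 ("`k̄_3² ≡ −f²/2t mod 2`", `f = 1`)] [cite: Huybrechts2016K3, Ch. 14 §0.1] -/
theorem discriminantQuad_mk_snd (ht : 0 < t) (h₁ : (B₀.prod ((-(2 * t : ℤ)) • LinearMap.mul ℤ ℤ)).Nondegenerate)
    (h₂ : (B₀.prod ((-(2 * t : ℤ)) • LinearMap.mul ℤ ℤ)).IsSymm) (h₃ : (B₀.prod ((-(2 * t : ℤ)) • LinearMap.mul ℤ ℤ)).IsEven) :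
    (B₀.prod ((-(2 * t : ℤ)) • LinearMap.mul ℤ ℤ)).discriminantQuad h₁ h₂ h₃ (Submodule.Quotient.mk (LinearMap.snd ℤ M ℤ)) =
      ((-1 / (2 * t) : ℚ) : AddCircle (2 : ℚ)) := by
  rw [discriminantQuad_mk, dualForm_eq_div_of_apply_eq_smul _ h₁ (n := (2 * t : ℤ)) (by positivity)
    (prod_neg_twoMul_smul_mul_zero_neg_one t) (LinearMap.snd ℤ M ℤ), LinearMap.snd_apply]
  congr 1
  push_cast
  ring

/-- **`q_L(m·γ) = −m²/2t mod 2ℤ`** (`q` is quadratic). (`t ≥ 1`.) [cite: GritsenkoHulekSankaran2010Symplectic, §4 proof of Cor. 4.7] [cite: Huybrechts2016K3, Ch. 14 §0.1] -/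
theorem discriminantQuad_zsmul_mk_snd (ht : 0 < t) (h₁ : (B₀.prod ((-(2 * t : ℤ)) • LinearMap.mul ℤ ℤ)).Nondegenerate)
    (h₂ : (B₀.prod ((-(2 * t : ℤ)) • LinearMap.mul ℤ ℤ)).IsSymm) (h₃ : (B₀.prod ((-(2 * t : ℤ)) • LinearMap.mul ℤ ℤ)).IsEven)
    (m : ℤ) :
    (B₀.prod ((-(2 * t : ℤ)) • LinearMap.mul ℤ ℤ)).discriminantQuad h₁ h₂ h₃ (m • Submodule.Quotient.mk (LinearMap.snd ℤ M ℤ)) =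
      ((-(m : ℚ) ^ 2 / (2 * t) : ℚ) : AddCircle (2 : ℚ)) := by
  rw [discriminantQuad_smul, discriminantQuad_mk_snd t ht, ← AddCircle.coe_zsmul, zsmul_eq_mul]
  congr 1
  push_cast
  ring

/-- **"`O(D(L_{2t})) ≅ {x mod 2t ∣ x² ≡ 1 mod 4t}`", the condition**: the homothety `x ↦ sx` of `A_L` preserves `q_L`
iff `4t ∣ s² − 1` (`q(sγ) − q(γ) = −(s² − 1)/2t` must lie in `2ℤ`). (`B₀` unimodular, `t ≥ 1`.)
[cite: GritsenkoHulekSankaran2010Symplectic, §4 proof of Cor. 4.7] [cite: GritsenkoHulek1998, (cited as [GH])] -/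
theorem forall_discriminantQuad_zsmul_iff_prod_neg_twoMul (hu : B₀.IsUnimodular) (ht : 0 < t)
    (h₁ : (B₀.prod ((-(2 * t : ℤ)) • LinearMap.mul ℤ ℤ)).Nondegenerate)
    (h₂ : (B₀.prod ((-(2 * t : ℤ)) • LinearMap.mul ℤ ℤ)).IsSymm) (h₃ : (B₀.prod ((-(2 * t : ℤ)) • LinearMap.mul ℤ ℤ)).IsEven)
    (s : ℤ) :
    (∀ a, (B₀.prod ((-(2 * t : ℤ)) • LinearMap.mul ℤ ℤ)).discriminantQuad h₁ h₂ h₃ (s • a) =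
        (B₀.prod ((-(2 * t : ℤ)) • LinearMap.mul ℤ ℤ)).discriminantQuad h₁ h₂ h₃ a) ↔ (4 * t : ℤ) ∣ s ^ 2 - 1 := by
  have h2t : (2 * t : ℚ) ≠ 0 := by positivity
  constructor
  · intro h
    have hg := h (Submodule.Quotient.mk (LinearMap.snd ℤ M ℤ))
    rw [discriminantQuad_zsmul_mk_snd t ht, discriminantQuad_mk_snd t ht, ← sub_eq_zero, ← AddCircle.coe_sub,
      AddCircle.coe_eq_zero_iff] at hg
    obtain ⟨k, hk⟩ := hg
    have hq : ((s ^ 2 - 1 : ℤ) : ℚ) = ((4 * t * (-k) : ℤ) : ℚ) := by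
      have hk' := congrArg (fun q : ℚ ↦ q * (2 * t)) hk
      simp only [zsmul_eq_mul, sub_mul, div_mul_cancel₀ _ h2t] at hk'
      push_cast at hk' ⊢
      linarith
    exact ⟨-k, by exact_mod_cast hq⟩
  · rintro ⟨k, hk⟩ a
    obtain ⟨φ, rfl⟩ := Submodule.Quotient.mk_surjective _ a
    have hk' : ((s : ℚ) ^ 2 - 1) = 4 * t * k := by exact_mod_cast hk
    rw [mk_eq_zsmul_mk_snd t hu φ, smul_smul, discriminantQuad_zsmul_mk_snd t ht, discriminantQuad_zsmul_mk_snd t ht,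
      eq_comm, ← sub_eq_zero, ← AddCircle.coe_sub, AddCircle.coe_eq_zero_iff]
    refine ⟨k * (φ ((0 : M), (1 : ℤ))) ^ 2, ?_⟩
    rw [zsmul_eq_mul, ← sub_div, eq_div_iff h2t]
    push_cast
    linear_combination (-((φ ((0 : M), (1 : ℤ)) : ℚ) ^ 2)) * hk'

omit [Module.Finite ℤ M] [Module.Free ℤ M] in
/-- **`4t ∣ s² − 1 ⟹ s·s·a = a` on `A_L`**: the admissible homotheties are involutions ("this abelian `2`-group").
(`B₀` unimodular.) [cite: GritsenkoHulekSankaran2010Symplectic, §4 proof of Cor. 4.7 ("the action of this abelian `2`-group")] -/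
theorem zsmul_zsmul_eq_self_prod_neg_twoMul (hu : B₀.IsUnimodular) {s : ℤ} (hs : (4 * t : ℤ) ∣ s ^ 2 - 1)
    (a : (B₀.prod ((-(2 * t : ℤ)) • LinearMap.mul ℤ ℤ)).discriminantGroup) : s • s • a = a := by
  obtain ⟨k, hk⟩ := hs
  obtain ⟨φ, rfl⟩ := Submodule.Quotient.mk_surjective _ a
  rw [mk_eq_zsmul_mk_snd t hu φ, smul_smul, smul_smul,
    show s * s * φ ((0 : M), (1 : ℤ)) = φ ((0 : M), (1 : ℤ)) + (2 * k * φ ((0 : M), (1 : ℤ))) * (2 * t) by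
      linear_combination (φ ((0 : M), (1 : ℤ))) * hk,
    add_smul, mul_smul, two_mul_zsmul_mk_snd_eq_zero, add_eq_left]
  exact smul_zero _

end Quad

/-! ### §3 "The natural projection `O(L_{2t}) → O(D(L_{2t}))` is surjective": every admissible `s` is some `ḡ` -/

section Lift

variable {M : Type u} [AddCommGroup M] [Module.Finite ℤ M] [Module.Free ℤ M] {B₀ : BilinForm ℤ M} (t : ℕ)

/-- **Every `s` with `s² ≡ 1 (mod 4t)` is induced by an isometry of `L = B₀ ⊕ ⟨−2t⟩`**: there is `g ∈ O(L)` acting on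
`A_L` as `x ↦ sx` ("The natural projection `O(L_{2t}) → O(D(L_{2t}))` is surjective (see [Nik])" — the tree's Nikulin
lifting through the hyperbolic pair `(x, 0), (y, 0)` of `L`, applied to the isometry `x ↦ sx` of `(A_L, q_L)` of §2).
`B₀` even unimodular with two orthogonal hyperbolic pairs, `t ≥ 1`.
[cite: GritsenkoHulekSankaran2010Symplectic, §4 proof of Cor. 4.7] [cite: Nikulin1980, Thm. 1.14.2] [cite: Huybrechts2016K3, Ch. 14 Thm. 2.4] -/
theorem exists_isometryEquiv_discriminantGroupCongr_eq_zsmul (hu : B₀.IsUnimodular) (he : B₀.IsEven) (ht : 0 < t)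
    {x y x₁ y₁ : M} (h : TwoHyperbolicPairs B₀ x y x₁ y₁) {s : ℤ} (hs : (4 * t : ℤ) ∣ s ^ 2 - 1) :
    ∃ g : (B₀.prod ((-(2 * t : ℤ)) • LinearMap.mul ℤ ℤ)).IsometryEquiv (B₀.prod ((-(2 * t : ℤ)) • LinearMap.mul ℤ ℤ)),
      ∀ a, g.discriminantGroupCongr a = s • a := by
  obtain ⟨hsL, heL⟩ := isSymm_isEven_prod_neg_twoMul_smul_mul B₀ t h.isSymm he
  have hL := nondegenerate_prod_neg_twoMul_smul_mul B₀ t hu ht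
  have h2 := h.inl (S := (-(2 * t : ℤ)) • LinearMap.mul ℤ ℤ) (isSymm_smul_mul _)
  have hinv : ((s • LinearMap.id : (B₀.prod ((-(2 * t : ℤ)) • LinearMap.mul ℤ ℤ)).discriminantGroup →ₗ[ℤ]
      (B₀.prod ((-(2 * t : ℤ)) • LinearMap.mul ℤ ℤ)).discriminantGroup).comp (s • LinearMap.id)) = LinearMap.id :=
    LinearMap.ext fun a ↦ zsmul_zsmul_eq_self_prod_neg_twoMul t hu hs a
  obtain ⟨g, hg⟩ := exists_isometryEquiv_discriminantGroupCongr_eq_of_hyperbolic_pair _ hL hsL heL h2.xx h2.yy h2.xy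
    (LinearEquiv.ofLinear (s • LinearMap.id) (s • LinearMap.id) hinv hinv)
    (fun a ↦ (forall_discriminantQuad_zsmul_iff_prod_neg_twoMul t hu ht hL hsL heL s).2 hs a)
  exact ⟨g, fun a ↦ (hg a).trans rfl⟩

/-- **Conversely, every `g ∈ O(L)` acts on `A_L` as `x ↦ sx` for some `s` with `s² ≡ 1 (mod 4t)`** — together with
§1–§2: "`O(D(L_{2t})) ≅ {x mod 2t ∣ x² ≡ 1 mod 4t}`" and `O(L_{2t})` maps ONTO it. (`B₀` symmetric even unimodular,
`t ≥ 1`.) [cite: GritsenkoHulekSankaran2010Symplectic, §4 proof of Cor. 4.7] [cite: GritsenkoHulek1998, (cited as [GH])] -/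
theorem exists_int_discriminantGroupCongr_eq_zsmul (hu : B₀.IsUnimodular) (hs₀ : B₀.IsSymm) (he : B₀.IsEven) (ht : 0 < t)
    (g : (B₀.prod ((-(2 * t : ℤ)) • LinearMap.mul ℤ ℤ)).IsometryEquiv (B₀.prod ((-(2 * t : ℤ)) • LinearMap.mul ℤ ℤ))) :
    ∃ s : ℤ, (4 * t : ℤ) ∣ s ^ 2 - 1 ∧ ∀ a, g.discriminantGroupCongr a = s • a := by
  obtain ⟨hsL, heL⟩ := isSymm_isEven_prod_neg_twoMul_smul_mul B₀ t hs₀ he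
  have hL := nondegenerate_prod_neg_twoMul_smul_mul B₀ t hu ht
  obtain ⟨s, hs⟩ := exists_int_forall_apply_eq_zsmul_prod_neg_twoMul t hu g.discriminantGroupCongr.toLinearMap.toAddMonoidHom
  have hs' : ∀ a, g.discriminantGroupCongr a = s • a := fun a ↦ hs a
  refine ⟨s, (forall_discriminantQuad_zsmul_iff_prod_neg_twoMul t hu ht hL hsL heL s).1 fun a ↦ ?_, hs'⟩
  rw [← hs' a]
  exact g.discriminantQuad_discriminantGroupCongr hL hsL heL hL hsL heL a

end Lift

/-! ### §4 `ḡ = (x ↦ sx)` multiplies the `l_t`-coordinate by `s` modulo the divisor -/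

section Coordinates

/-- **`ḡ = s· ⟹ gl ≡ sl (mod δL)`** whenever `δ ∣ (l, z)` for all `z` (`l* = l/δ ∈ L^∨`, `[(gl)*] = ḡ[l*] = s[l*] = [(sl)*]`);
any nondegenerate lattice, `δ ≠ 0`. For `s = 1` this is "`Õ(L)` fixes `l* + L`" of `LatticeFormsNegTwoDVectorOrbitCount`.
[cite: GritsenkoHulekSankaran2010Symplectic, §4 proof of Cor. 4.7 ("all solutions `c mod f` … are equivalent modulo the action of this abelian `2`-group")] [cite: GritsenkoHulekSankaran2009, §3.3] -/
theorem exists_smul_eq_apply_sub_zsmul_of_discriminantGroupCongr_eq_zsmul {W : Type*} [AddCommGroup W]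
    [Module.Finite ℤ W] [Module.Free ℤ W] {B : BilinForm ℤ W} (hB : B.Nondegenerate) (g : B.IsometryEquiv B) {s : ℤ}
    (hg : ∀ a, g.discriminantGroupCongr a = s • a) {l : W} {δ : ℤ} (hδ : δ ≠ 0) (h : ∀ z, δ ∣ B l z) :
    ∃ w : W, δ • w = g l - s • l := by
  obtain ⟨f, hf⟩ := exists_dual_smul_eq_of_forall_dvd B h
  have hf' : δ • (g : W ≃ₗ[ℤ] W).symm.dualMap f = B (g l) := by
    rw [← map_zsmul, hf, g.symm_dualMap_apply_apply]
  have hsf : δ • (s • f) = B (s • l) := by rw [smul_comm, hf, map_zsmul]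
  have hcl : (Submodule.Quotient.mk ((g : W ≃ₗ[ℤ] W).symm.dualMap f) : B.discriminantGroup) =
      Submodule.Quotient.mk (s • f) := by
    rw [← g.discriminantGroupCongr_mk, hg]
    rfl
  exact (exists_smul_eq_sub_iff_mk_eq_mk hB hδ hf' hsf).2 hcl

variable {M : Type u} [AddCommGroup M] [Module.Finite ℤ M] [Module.Free ℤ M] {B₀ : BilinForm ℤ M} (t : ℕ)

/-- In `B₀ ⊕ ⟨−2t⟩` (`B₀` unimodular, `t ≥ 1`): **if `ḡ` is the homothety `x ↦ sx` and `δ ∣ (h, L)`, then the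
`l_t`-coordinate of `gh` is `≡ s·c (mod δ)`**, `c` the `l_t`-coordinate of `h` (`h^* ≡ (c/f) l_t`, `(gh)^* = ḡ h^* ≡ (sc/f) l_t`).
[cite: GritsenkoHulekSankaran2010Symplectic, §4 proof of Cor. 4.7 and of Prop. 4.6 ("`h_d^* ≡ (c/f) l_t mod L_{2t}`")] -/
theorem dvd_snd_apply_sub_mul_snd_of_discriminantGroupCongr_eq_zsmul (hu : B₀.IsUnimodular) (ht : 0 < t)
    (g : (B₀.prod ((-(2 * t : ℤ)) • LinearMap.mul ℤ ℤ)).IsometryEquiv (B₀.prod ((-(2 * t : ℤ)) • LinearMap.mul ℤ ℤ)))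
    {s : ℤ} (hg : ∀ a, g.discriminantGroupCongr a = s • a) {r : M × ℤ} {δ : ℤ} (hδ : δ ≠ 0)
    (h : ∀ z, δ ∣ B₀.prod ((-(2 * t : ℤ)) • LinearMap.mul ℤ ℤ) r z) : δ ∣ (g r).2 - s * r.2 := by
  obtain ⟨w, hw⟩ := exists_smul_eq_apply_sub_zsmul_of_discriminantGroupCongr_eq_zsmul
    (nondegenerate_prod_neg_twoMul_smul_mul B₀ t hu ht) g hg hδ h
  have h2 := congrArg Prod.snd hw
  simp only [Prod.smul_snd, Prod.snd_sub, smul_eq_mul] at h2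
  exact ⟨w.2, by linarith⟩

end Coordinates

/-! ### §5 The arithmetic of `w = 1` -/

section Arithmetic

/-- **Chinese-remainder core**: if `(F, N) = 1`, `(c, F) = 1` and `F ∣ c'² − c²`, then some `s` has `FN ∣ s² − 1` and
`F ∣ sc − c'` — take `s ≡ c'/c (mod F)` (a square root of `1` mod `F`) and `s ≡ 1 (mod N)`.
[cite: GritsenkoHulekSankaran2010Symplectic, §4 proof of Cor. 4.7 ("all solutions `c mod f` … are equivalent modulo the action of this abelian `2`-group")] -/
theorem exists_sq_sub_one_dvd_of_isCoprime {F N c c' : ℤ} (hFN : IsCoprime F N) (hcF : IsCoprime c F)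
    (hX : F ∣ c' ^ 2 - c ^ 2) : ∃ s : ℤ, F * N ∣ s ^ 2 - 1 ∧ F ∣ s * c - c' := by
  obtain ⟨p, q, hpq⟩ := hcF
  obtain ⟨r, hr⟩ := hX
  obtain ⟨a, b, hab⟩ := hFN
  -- `u = c'/c mod F`, then `s ≡ u (F)`, `s ≡ 1 (N)`
  set u : ℤ := c' * p with hu
  have hu1 : F ∣ u * c - c' := ⟨-(q * c'), by rw [hu]; linear_combination c' * hpq⟩
  have hu2 : F ∣ u ^ 2 - 1 := ⟨r * p ^ 2 - q * (p * c + 1), by rw [hu]; linear_combination p ^ 2 * hr + (p * c + 1) * hpq⟩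
  set s : ℤ := u * (b * N) + a * F with hsdef
  have hsF : F ∣ s - u := ⟨a * (1 - u), by rw [hsdef]; linear_combination u * hab⟩
  have hsN : N ∣ s - 1 := ⟨b * (u - 1), by rw [hsdef]; linear_combination hab⟩
  refine ⟨s, IsCoprime.mul_dvd ⟨a, b, hab⟩ ?_ ?_, ?_⟩
  · have e : s ^ 2 - 1 = (s - u) * (s + u) + (u ^ 2 - 1) := by ring
    rw [e]
    exact dvd_add (hsF.mul_right _) hu2
  · have e : s ^ 2 - 1 = (s - 1) * (s + 1) := by ring
    rw [e]
    exact hsN.mul_right _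
  · have e : s * c - c' = (s - u) * c + (u * c - c') := by ring
    rw [e]
    exact dvd_add (hsF.mul_right _) hu1

/-- **`f² ∣ d + c²t ⟹ f ∣ 2d/f + (2t/f)·c²`** (`2t = fm`, `2d = fe`, `f ≠ 0`: `f(e + mc²) = 2(d + c²t) ∈ 2f²ℤ`).
[cite: GritsenkoHulekSankaran2010Symplectic, §4 proof of Prop. 4.6 (display (c-eq): "`2f₁b = g₁(d₁ + c²t₁)`")] -/
theorem dvd_add_mul_sq_of_sq_dvd {f m e t d c : ℤ} (hf0 : f ≠ 0) (hm : 2 * t = f * m) (he : 2 * d = f * e)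
    (h : f ^ 2 ∣ d + t * c ^ 2) : f ∣ e + m * c ^ 2 := by
  obtain ⟨q, hq⟩ := h
  refine ⟨2 * q, mul_left_cancel₀ hf0 ?_⟩
  linear_combination -he - c ^ 2 * hm + 2 * hq

/-- **`w = 1 ⟹ (f, 2t/f) = 1`** in the presence of an admissible `c`: with `2t = fm`, `2d = fe` and `f² ∣ d + c²t`
(`f ≠ 0`), `((m, e), f) = 1` forces `(f, m) = 1` — since `(f, m)` divides `e + mc²`, hence `e`, hence `w`.
[cite: GritsenkoHulekSankaran2010Symplectic, §4 Cor. 4.7 ("Let us assume that `w = 1`") and Prop. 4.6 ("`g = (2t/f, 2d/f)`, `w = (g, f)`")] -/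
theorem gcd_eq_one_of_w_eq_one {f m e t d c : ℤ} (hf0 : f ≠ 0) (hm : 2 * t = f * m) (he : 2 * d = f * e)
    (h : f ^ 2 ∣ d + t * c ^ 2) (hw : Int.gcd (Int.gcd m e : ℤ) f = 1) : Int.gcd f m = 1 := by
  obtain ⟨q, hq⟩ := dvd_add_mul_sq_of_sq_dvd hf0 hm he h
  obtain ⟨a, b, hab⟩ := Int.isCoprime_iff_gcd_eq_one.2 hw
  have hg := Int.gcd_eq_gcd_ab m e
  rw [Int.isCoprime_iff_gcd_eq_one.symm]
  refine ⟨b + a * q * Int.gcdB m e, a * (Int.gcdA m e - c ^ 2 * Int.gcdB m e), ?_⟩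
  linear_combination hab - a * hg - a * Int.gcdB m e * hq

/-- **Conversely `(f, 2t/f) = 1 ⟹ w = ((2t/f, 2d/f), f) = 1`** (`(m, e) ∣ m`). So, for polarisation types that occur,
`w = 1` is exactly the condition `(f, 2t/f) = 1`. [cite: GritsenkoHulekSankaran2010Symplectic, §4 Prop. 4.6 and Remark 4.14] -/
theorem w_eq_one_of_gcd_eq_one {f m : ℤ} (e : ℤ) (h : Int.gcd f m = 1) : Int.gcd (Int.gcd m e : ℤ) f = 1 := by
  rw [← Int.isCoprime_iff_gcd_eq_one] at h ⊢
  exact h.symm.of_isCoprime_of_dvd_left (Int.gcd_dvd_left m e)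

/-- **The arithmetic of Cor. 4.7**: `t ≥ 1`, `2t = fm` with `(f, m) = 1`; if `c, c'` are both admissible for `(t, d, f)`
(`(c, f) = 1`, `f² ∣ d + c²t`, `f² ∣ d + c'²t`), then there is `s` with `s² ≡ 1 (mod 4t)` and `sc ≡ c' (mod f)` — i.e.
the two solutions `c mod f` "are equivalent modulo the action of this abelian `2`-group" `{x mod 2t ∣ x² ≡ 1 mod 4t}`.
[cite: GritsenkoHulekSankaran2010Symplectic, §4 proof of Cor. 4.7] -/
theorem exists_four_mul_dvd_sq_sub_one_and_dvd {t f m d c c' : ℤ} (hm : 2 * t = f * m)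
    (hfm : Int.gcd f m = 1) (hc : Int.gcd f c = 1) (hd : f ^ 2 ∣ d + t * c ^ 2) (hd' : f ^ 2 ∣ d + t * c' ^ 2)
    (hf0 : f ≠ 0) : ∃ s : ℤ, 4 * t ∣ s ^ 2 - 1 ∧ f ∣ s * c - c' := by
  have hcop : IsCoprime f m := Int.isCoprime_iff_gcd_eq_one.2 hfm
  have hcf : IsCoprime c f := (Int.isCoprime_iff_gcd_eq_one.2 hc).symm
  -- `f² ∣ t(c'² − c²)`, i.e. `m(c'² − c²) = 2fq`
  obtain ⟨q, hq⟩ : f ^ 2 ∣ t * (c' ^ 2 - c ^ 2) := by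
    have e : t * (c' ^ 2 - c ^ 2) = (d + t * c' ^ 2) - (d + t * c ^ 2) := by ring
    rw [e]
    exact dvd_sub hd' hd
  have key : m * (c' ^ 2 - c ^ 2) = f * (2 * q) := by
    apply mul_left_cancel₀ hf0
    linear_combination -(c' ^ 2 - c ^ 2) * hm + 2 * hq
  have h4t : 4 * t = 2 * f * m := by linear_combination 2 * hm
  rcases Int.even_or_odd f with ⟨k, hk⟩ | ⟨k, hk⟩
  · -- `f = 2k` even: `F = 2f`, `N = m`
    have h2m : IsCoprime 2 m := by
      have : IsCoprime (2 * k) m := by rw [two_mul, ← hk]; exact hcop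
      exact this.of_mul_left_left
    have hc2 : IsCoprime c 2 := by
      have : IsCoprime (2 * k) c := by rw [two_mul, ← hk]; exact hcf.symm
      exact this.of_mul_left_left.symm
    have hFN : IsCoprime (2 * f) m := h2m.mul_left hcop
    have hcF : IsCoprime c (2 * f) := hc2.mul_right hcf
    have hX : 2 * f ∣ c' ^ 2 - c ^ 2 := by
      refine hFN.dvd_of_dvd_mul_left ⟨q, ?_⟩
      linear_combination key
    obtain ⟨s, hs1, hs2⟩ := exists_sq_sub_one_dvd_of_isCoprime hFN hcF hX
    refine ⟨s, ?_, (dvd_mul_left f 2).trans hs2⟩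
    rwa [h4t]
  · -- `f = 2k + 1` odd: `F = f`, `N = 2m`
    have hf2 : IsCoprime f 2 := ⟨1, -k, by rw [hk]; ring⟩
    have hFN : IsCoprime f (2 * m) := hf2.mul_right hcop
    have hX : f ∣ c' ^ 2 - c ^ 2 := hcop.dvd_of_dvd_mul_left ⟨2 * q, by linear_combination key⟩
    obtain ⟨s, hs1, hs2⟩ := exists_sq_sub_one_dvd_of_isCoprime hFN hcf hX
    refine ⟨s, ?_, hs2⟩
    rw [h4t]
    have e : 2 * f * m = f * (2 * m) := by ring
    rwa [e]

end Arithmetic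

/-! ### §6 Corollary 4.7: one `O(L)`-orbit for `w = 1` -/

section Orbit

variable {M : Type u} [AddCommGroup M] [Module.Finite ℤ M] [Module.Free ℤ M] {B₀ : BilinForm ℤ M} (t : ℕ)

/-- **Cor. 4.7 with the hypothesis in the form `(f, 2t/f) = 1`**: in `L = B₀ ⊕ ⟨−2t⟩` (`B₀` even unimodular with two
orthogonal hyperbolic pairs, `t ≥ 1`), two primitive vectors `h, h'` with `h² = h'² = 2d` and `(h, L) = (h', L) = fℤ` are
`O(L)`-equivalent as soon as `(f, 2t/f) = 1`. Proof as printed: their `l_t`-coordinates `c, c'` are admissible, §5 gives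
`s` with `4t ∣ s² − 1`, `f ∣ sc − c'`, §3 lifts `x ↦ sx` to `g₁ ∈ O(L)`, §4 gives `(g₁h).l_t ≡ c' (mod f)`, and the Eichler
criterion (`Õ(L)`) carries `g₁h` to `h'`. [cite: GritsenkoHulekSankaran2010Symplectic, §4 Cor. 4.7 and its proof] [cite: Nikulin1980, Thm. 1.14.2] [cite: GritsenkoHulekSankaran2009, Prop. 3.3 (i)] -/
theorem exists_isometryEquiv_apply_eq_of_divisor_of_gcd_eq_one (hu : B₀.IsUnimodular) (he : B₀.IsEven) (ht : 0 < t)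
    {x y x₁ y₁ : M} (h : TwoHyperbolicPairs B₀ x y x₁ y₁) {r s r' s' : M × ℤ} {f d : ℤ}
    (hgcd : Int.gcd f (2 * t / f) = 1)
    (hr : B₀.prod ((-(2 * t : ℤ)) • LinearMap.mul ℤ ℤ) r r = 2 * d) (hr0 : r ≠ 0)
    (hrsat : ∀ (k : ℤ) (w : M × ℤ), k ≠ 0 → k • w ∈ ℤ ∙ r → w ∈ ℤ ∙ r)
    (hfr : ∀ z, f ∣ B₀.prod ((-(2 * t : ℤ)) • LinearMap.mul ℤ ℤ) r z) (hr' : B₀.prod ((-(2 * t : ℤ)) • LinearMap.mul ℤ ℤ) r r' = f)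
    (hs : B₀.prod ((-(2 * t : ℤ)) • LinearMap.mul ℤ ℤ) s s = 2 * d) (hs0 : s ≠ 0)
    (hssat : ∀ (k : ℤ) (w : M × ℤ), k ≠ 0 → k • w ∈ ℤ ∙ s → w ∈ ℤ ∙ s)
    (hfs : ∀ z, f ∣ B₀.prod ((-(2 * t : ℤ)) • LinearMap.mul ℤ ℤ) s z) (hs' : B₀.prod ((-(2 * t : ℤ)) • LinearMap.mul ℤ ℤ) s s' = f) :
    ∃ g : (B₀.prod ((-(2 * t : ℤ)) • LinearMap.mul ℤ ℤ)).IsometryEquiv (B₀.prod ((-(2 * t : ℤ)) • LinearMap.mul ℤ ℤ)),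
      g r = s := by
  haveI : Module.IsTorsionFree ℤ M := inferInstance
  have hf0 : f ≠ 0 := by
    rintro rfl
    exact hr0 ((nondegenerate_prod_neg_twoMul_smul_mul B₀ t hu ht).1 r fun z ↦ zero_dvd_iff.1 (hfr z))
  -- the `l_t`-coordinates are admissible
  have hc : Int.gcd f r.2 = 1 := gcd_snd_eq_one_of_primitive_of_forall_dvd t hu hr0 hrsat hfr
  have hc' : Int.gcd f s.2 = 1 := gcd_snd_eq_one_of_primitive_of_forall_dvd t hu hs0 hssat hfs
  have hd : f ^ 2 ∣ d + t * r.2 ^ 2 := sq_dvd_add_mul_snd_sq_of_forall_dvd t hu he hr hfr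
  have hd' : f ^ 2 ∣ d + t * s.2 ^ 2 := sq_dvd_add_mul_snd_sq_of_forall_dvd t hu he hs hfs
  -- `f ∣ 2t` (`f ∣ 2tc` with `(f, c) = 1`), `2t = f · (2t/f)`
  have hft : f ∣ 2 * t :=
    (Int.isCoprime_iff_gcd_eq_one.2 hc).dvd_of_dvd_mul_right (dvd_two_mul_mul_snd_of_forall_dvd t hfr)
  have hm : 2 * (t : ℤ) = f * (2 * t / f) := (Int.mul_ediv_cancel' hft).symm
  obtain ⟨σ, hσ, hσc⟩ := exists_four_mul_dvd_sq_sub_one_and_dvd hm hgcd hc hd hd' hf0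
  -- lift `x ↦ σx` to `g₁ ∈ O(L)`; then `(g₁ r).l_t ≡ σ c ≡ c' (mod f)`
  obtain ⟨g₁, hg₁⟩ := exists_isometryEquiv_discriminantGroupCongr_eq_zsmul t hu he ht h (s := σ) (by exact_mod_cast hσ)
  have hdvd : f ∣ (g₁ r).2 - σ * r.2 := dvd_snd_apply_sub_mul_snd_of_discriminantGroupCongr_eq_zsmul t hu ht g₁ hg₁ hf0 hfr
  have hst : f ∣ (g₁ r).2 - s.2 := by
    have e : (g₁ r).2 - s.2 = ((g₁ r).2 - σ * r.2) + (σ * r.2 - s.2) := by ring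
    rw [e]
    exact dvd_add hdvd hσc
  -- Eichler: `g₁ r` and `s` have the same invariants
  have hg₁r : B₀.prod ((-(2 * t : ℤ)) • LinearMap.mul ℤ ℤ) (g₁ r) (g₁ r) = B₀.prod ((-(2 * t : ℤ)) • LinearMap.mul ℤ ℤ) s s := by
    rw [g₁.map_app, hr, hs]
  have hfg₁r : ∀ z, f ∣ B₀.prod ((-(2 * t : ℤ)) • LinearMap.mul ℤ ℤ) (g₁ r) z :=
    (forall_dvd_apply_iff_of_isometryEquiv g₁ r f).2 hfr
  have hg₁r' : B₀.prod ((-(2 * t : ℤ)) • LinearMap.mul ℤ ℤ) (g₁ r) (g₁ r') = f := by rw [g₁.map_app, hr']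
  obtain ⟨g₂, -, hg₂⟩ := (exists_stable_isometryEquiv_apply_eq_iff_dvd_snd_sub_snd t hu he ht h hf0 hg₁r hfg₁r hfs
    hg₁r' hs').2 hst
  exact ⟨g₁.trans g₂, by change g₂ (g₁ r) = s; exact hg₂⟩

/-- **Corollary 4.7 (Gritsenko–Hulek–Sankaran).** "Let us assume that `w = 1`. If there exists a primitive vector
`h_d ∈ L_{2t}` such that `h_d² = 2d` and `div(h_d) = f`, then all such vectors belong to the same `O(L_{2t})`-orbit" —
in `L = B₀ ⊕ ⟨−2t⟩` (`B₀` even unimodular with two orthogonal hyperbolic pairs, `t ≥ 1`), with `w = (g, f)`,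
`g = (2t/f, 2d/f)` as printed (integer divisions; `f ∣ 2t`, `f ∣ 2d` hold for such vectors): any two primitive `h, h'`
with `h² = h'² = 2d`, `(h, L) = (h', L) = fℤ` are `O(L)`-equivalent. [cite: GritsenkoHulekSankaran2010Symplectic, §4 Cor. 4.7] [cite: Nikulin1980, Thm. 1.14.2] [cite: GritsenkoHulekSankaran2009, Prop. 3.3 (i)] -/
theorem exists_isometryEquiv_apply_eq_of_divisor_of_w_eq_one (hu : B₀.IsUnimodular) (he : B₀.IsEven) (ht : 0 < t)
    {x y x₁ y₁ : M} (h : TwoHyperbolicPairs B₀ x y x₁ y₁) {r s r' s' : M × ℤ} {f d : ℤ}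
    (hw : Int.gcd (Int.gcd (2 * t / f) (2 * d / f) : ℤ) f = 1)
    (hr : B₀.prod ((-(2 * t : ℤ)) • LinearMap.mul ℤ ℤ) r r = 2 * d) (hr0 : r ≠ 0)
    (hrsat : ∀ (k : ℤ) (w : M × ℤ), k ≠ 0 → k • w ∈ ℤ ∙ r → w ∈ ℤ ∙ r)
    (hfr : ∀ z, f ∣ B₀.prod ((-(2 * t : ℤ)) • LinearMap.mul ℤ ℤ) r z) (hr' : B₀.prod ((-(2 * t : ℤ)) • LinearMap.mul ℤ ℤ) r r' = f)
    (hs : B₀.prod ((-(2 * t : ℤ)) • LinearMap.mul ℤ ℤ) s s = 2 * d) (hs0 : s ≠ 0)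
    (hssat : ∀ (k : ℤ) (w : M × ℤ), k ≠ 0 → k • w ∈ ℤ ∙ s → w ∈ ℤ ∙ s)
    (hfs : ∀ z, f ∣ B₀.prod ((-(2 * t : ℤ)) • LinearMap.mul ℤ ℤ) s z) (hs' : B₀.prod ((-(2 * t : ℤ)) • LinearMap.mul ℤ ℤ) s s' = f) :
    ∃ g : (B₀.prod ((-(2 * t : ℤ)) • LinearMap.mul ℤ ℤ)).IsometryEquiv (B₀.prod ((-(2 * t : ℤ)) • LinearMap.mul ℤ ℤ)),
      g r = s := by
  haveI : Module.IsTorsionFree ℤ M := inferInstance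
  have hf0 : f ≠ 0 := by
    rintro rfl
    exact hr0 ((nondegenerate_prod_neg_twoMul_smul_mul B₀ t hu ht).1 r fun z ↦ zero_dvd_iff.1 (hfr z))
  have hc : Int.gcd f r.2 = 1 := gcd_snd_eq_one_of_primitive_of_forall_dvd t hu hr0 hrsat hfr
  have hd : f ^ 2 ∣ d + t * r.2 ^ 2 := sq_dvd_add_mul_snd_sq_of_forall_dvd t hu he hr hfr
  have hft : f ∣ 2 * t :=
    (Int.isCoprime_iff_gcd_eq_one.2 hc).dvd_of_dvd_mul_right (dvd_two_mul_mul_snd_of_forall_dvd t hfr)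
  have hfd : f ∣ 2 * d := by rw [← hr]; exact hfr r
  have hm : 2 * (t : ℤ) = f * (2 * t / f) := (Int.mul_ediv_cancel' hft).symm
  have hde : 2 * d = f * (2 * d / f) := (Int.mul_ediv_cancel' hfd).symm
  exact exists_isometryEquiv_apply_eq_of_divisor_of_gcd_eq_one t hu he ht h (gcd_eq_one_of_w_eq_one hf0 hm hde hd hw)
    hr hr0 hrsat hfr hr' hs hs0 hssat hfs hs'

/-- **Remark 4.14: "this condition is true for any vector `h_d` if `2t` is square free"** — for squarefree `2t`, any two
primitive `h, h'` of `B₀ ⊕ ⟨−2t⟩` with the same square and the same divisor `f` are `O(L)`-equivalent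
(`(f, 2t/f) = 1` automatically). [cite: GritsenkoHulekSankaran2010Symplectic, §4 Remark 4.14 and Cor. 4.7] -/
theorem exists_isometryEquiv_apply_eq_of_divisor_of_squarefree (hu : B₀.IsUnimodular) (he : B₀.IsEven) (ht : 0 < t)
    (hsq : Squarefree (2 * t)) {x y x₁ y₁ : M} (h : TwoHyperbolicPairs B₀ x y x₁ y₁) {r s r' s' : M × ℤ} {f d : ℤ}
    (hr : B₀.prod ((-(2 * t : ℤ)) • LinearMap.mul ℤ ℤ) r r = 2 * d) (hr0 : r ≠ 0)
    (hrsat : ∀ (k : ℤ) (w : M × ℤ), k ≠ 0 → k • w ∈ ℤ ∙ r → w ∈ ℤ ∙ r)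
    (hfr : ∀ z, f ∣ B₀.prod ((-(2 * t : ℤ)) • LinearMap.mul ℤ ℤ) r z) (hr' : B₀.prod ((-(2 * t : ℤ)) • LinearMap.mul ℤ ℤ) r r' = f)
    (hs : B₀.prod ((-(2 * t : ℤ)) • LinearMap.mul ℤ ℤ) s s = 2 * d) (hs0 : s ≠ 0)
    (hssat : ∀ (k : ℤ) (w : M × ℤ), k ≠ 0 → k • w ∈ ℤ ∙ s → w ∈ ℤ ∙ s)
    (hfs : ∀ z, f ∣ B₀.prod ((-(2 * t : ℤ)) • LinearMap.mul ℤ ℤ) s z) (hs' : B₀.prod ((-(2 * t : ℤ)) • LinearMap.mul ℤ ℤ) s s' = f) :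
    ∃ g : (B₀.prod ((-(2 * t : ℤ)) • LinearMap.mul ℤ ℤ)).IsometryEquiv (B₀.prod ((-(2 * t : ℤ)) • LinearMap.mul ℤ ℤ)),
      g r = s := by
  haveI : Module.IsTorsionFree ℤ M := inferInstance
  have hc : Int.gcd f r.2 = 1 := gcd_snd_eq_one_of_primitive_of_forall_dvd t hu hr0 hrsat hfr
  have hft : f ∣ 2 * t :=
    (Int.isCoprime_iff_gcd_eq_one.2 hc).dvd_of_dvd_mul_right (dvd_two_mul_mul_snd_of_forall_dvd t hfr)
  have hm : 2 * (t : ℤ) = f * (2 * t / f) := (Int.mul_ediv_cancel' hft).symm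
  have hsq' : Squarefree (2 * (t : ℤ)) := by
    rw [show (2 * (t : ℤ)) = ((2 * t : ℕ) : ℤ) by push_cast; ring]
    exact Int.squarefree_natCast.2 hsq
  have hgcd : Int.gcd f (2 * t / f) = 1 := by
    rw [← Int.isCoprime_iff_gcd_eq_one]
    rw [hm] at hsq'
    exact (squarefree_mul_iff.1 hsq').1.isCoprime
  exact exists_isometryEquiv_apply_eq_of_divisor_of_gcd_eq_one t hu he ht h hgcd hr hr0 hrsat hfr hr' hs hs0 hssat hfs hs'

/-- **Cor. 4.7 as a count: exactly ONE `O(L)`-orbit** of primitive `h ∈ B₀ ⊕ ⟨−2t⟩` with `h² = 2d`, `(h, L) = fℤ`, when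
`w = 1` and "there exists a primitive vector `h_d ∈ L_{2t}` such that `h_d² = 2d` and `div(h_d) = f`" — to be contrasted
with the `Õ(L)`-count `#{c mod f : (c, f) = 1, f² ∣ d + c²t}` of Prop. 4.6 ("This number is not always `1`").
[cite: GritsenkoHulekSankaran2010Symplectic, §4 Cor. 4.7 and Prop. 4.6] -/
theorem natCard_quot_isometryEquiv_two_mul_of_divisor_of_w_eq_one (hu : B₀.IsUnimodular) (he : B₀.IsEven) (ht : 0 < t)
    {x y x₁ y₁ : M} (h : TwoHyperbolicPairs B₀ x y x₁ y₁) {f d : ℤ}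
    (hw : Int.gcd (Int.gcd (2 * t / f) (2 * d / f) : ℤ) f = 1)
    (hex : ∃ r r' : M × ℤ, B₀.prod ((-(2 * t : ℤ)) • LinearMap.mul ℤ ℤ) r r = 2 * d ∧ r ≠ 0 ∧
      (∀ (k : ℤ) (w : M × ℤ), k ≠ 0 → k • w ∈ ℤ ∙ r → w ∈ ℤ ∙ r) ∧
      (∀ z, f ∣ B₀.prod ((-(2 * t : ℤ)) • LinearMap.mul ℤ ℤ) r z) ∧ B₀.prod ((-(2 * t : ℤ)) • LinearMap.mul ℤ ℤ) r r' = f) :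
    Nat.card (Quot fun r s : {r : M × ℤ // B₀.prod ((-(2 * t : ℤ)) • LinearMap.mul ℤ ℤ) r r = 2 * d ∧ r ≠ 0 ∧
        (∀ (k : ℤ) (w : M × ℤ), k ≠ 0 → k • w ∈ ℤ ∙ r → w ∈ ℤ ∙ r) ∧
        (∀ z, f ∣ B₀.prod ((-(2 * t : ℤ)) • LinearMap.mul ℤ ℤ) r z) ∧
        ∃ r', B₀.prod ((-(2 * t : ℤ)) • LinearMap.mul ℤ ℤ) r r' = f} ↦
      ∃ g : (B₀.prod ((-(2 * t : ℤ)) • LinearMap.mul ℤ ℤ)).IsometryEquiv (B₀.prod ((-(2 * t : ℤ)) • LinearMap.mul ℤ ℤ)),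
        g r.1 = s.1) = 1 := by
  rw [Nat.card_eq_one_iff_unique]
  refine ⟨⟨?_⟩, ?_⟩
  · rintro ⟨⟨r, hr, hr0, hrsat, hfr, r', hr'⟩⟩ ⟨⟨s, hs, hs0, hssat, hfs, s', hs'⟩⟩
    exact Quot.sound (exists_isometryEquiv_apply_eq_of_divisor_of_w_eq_one t hu he ht h hw hr hr0 hrsat hfr hr' hs hs0
      hssat hfs hs')
  · obtain ⟨r, r', hr, hr0, hrsat, hfr, hr'⟩ := hex
    exact ⟨Quot.mk _ ⟨r, hr, hr0, hrsat, hfr, r', hr'⟩⟩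

end Orbit

/-! ### §7 The models `(E₈(−1)^{⊕m} ⊕ U^{⊕(n+2)}) ⊕ ℤ(−2t)` (`L_{2t}`: `m = 2`, `n = 1`; `Kumⁿ`: `m = 0`, `n = 1`) -/

section Model

variable (m n t : ℕ)

/-- **Cor. 4.7 for the models**: in `(E₈(−1)^{⊕m} ⊕ U^{⊕(n+2)}) ⊕ ℤ(−2t)` (`t ≥ 1`), two primitive vectors with
`h² = h'² = 2d`, `(h, L) = (h', L) = fℤ` and `w = ((2t/f, 2d/f), f) = 1` are `O(L)`-equivalent.
[cite: GritsenkoHulekSankaran2010Symplectic, §4 Cor. 4.7] -/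
theorem exists_isometryEquiv_model_apply_eq_of_divisor_of_w_eq_one (ht : 0 < t)
    {r s r' s' : ((Fin m → Fin 8 → ℤ) × ((Fin (n + 2) → ℤ) × (Fin (n + 2) → ℤ))) × ℤ} {f d : ℤ}
    (hw : Int.gcd (Int.gcd (2 * t / f) (2 * d / f) : ℤ) f = 1)
    (hr : (((LinearMap.BilinForm.pi fun _ : Fin m ↦ -e8Form).prod (hyperbolicSum (n + 2))).prod
      ((-(2 * t : ℤ)) • LinearMap.mul ℤ ℤ)) r r = 2 * d) (hr0 : r ≠ 0)
    (hrsat : ∀ (k : ℤ) (w : ((Fin m → Fin 8 → ℤ) × ((Fin (n + 2) → ℤ) × (Fin (n + 2) → ℤ))) × ℤ), k ≠ 0 →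
      k • w ∈ ℤ ∙ r → w ∈ ℤ ∙ r)
    (hfr : ∀ z, f ∣ (((LinearMap.BilinForm.pi fun _ : Fin m ↦ -e8Form).prod (hyperbolicSum (n + 2))).prod
      ((-(2 * t : ℤ)) • LinearMap.mul ℤ ℤ)) r z)
    (hr' : (((LinearMap.BilinForm.pi fun _ : Fin m ↦ -e8Form).prod (hyperbolicSum (n + 2))).prod
      ((-(2 * t : ℤ)) • LinearMap.mul ℤ ℤ)) r r' = f)
    (hs : (((LinearMap.BilinForm.pi fun _ : Fin m ↦ -e8Form).prod (hyperbolicSum (n + 2))).prod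
      ((-(2 * t : ℤ)) • LinearMap.mul ℤ ℤ)) s s = 2 * d) (hs0 : s ≠ 0)
    (hssat : ∀ (k : ℤ) (w : ((Fin m → Fin 8 → ℤ) × ((Fin (n + 2) → ℤ) × (Fin (n + 2) → ℤ))) × ℤ), k ≠ 0 →
      k • w ∈ ℤ ∙ s → w ∈ ℤ ∙ s)
    (hfs : ∀ z, f ∣ (((LinearMap.BilinForm.pi fun _ : Fin m ↦ -e8Form).prod (hyperbolicSum (n + 2))).prod
      ((-(2 * t : ℤ)) • LinearMap.mul ℤ ℤ)) s z)
    (hs' : (((LinearMap.BilinForm.pi fun _ : Fin m ↦ -e8Form).prod (hyperbolicSum (n + 2))).prod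
      ((-(2 * t : ℤ)) • LinearMap.mul ℤ ℤ)) s s' = f) :
    ∃ g : (((LinearMap.BilinForm.pi fun _ : Fin m ↦ -e8Form).prod (hyperbolicSum (n + 2))).prod
        ((-(2 * t : ℤ)) • LinearMap.mul ℤ ℤ)).IsometryEquiv
        (((LinearMap.BilinForm.pi fun _ : Fin m ↦ -e8Form).prod (hyperbolicSum (n + 2))).prod
        ((-(2 * t : ℤ)) • LinearMap.mul ℤ ℤ)), g r = s := by
  obtain ⟨-, heB, huB⟩ := isSymm_isEven_isUnimodular_pi_neg_e8Form_prod_hyperbolicSum' m (n + 2)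
  exact exists_isometryEquiv_apply_eq_of_divisor_of_w_eq_one t huB heB ht
    (twoHyperbolicPairs_pi_neg_e8Form_prod_hyperbolicSum_add_two m n) hw hr hr0 hrsat hfr hr' hs hs0 hssat hfs hs'

/-- **Cor. 4.7 as a count, for the models**: exactly one `O(L)`-orbit of primitive `h` with `h² = 2d`, `(h, L) = fℤ` in
`(E₈(−1)^{⊕m} ⊕ U^{⊕(n+2)}) ⊕ ℤ(−2t)` when `w = 1` and one such vector exists. [cite: GritsenkoHulekSankaran2010Symplectic, §4 Cor. 4.7] -/
theorem natCard_quot_isometryEquiv_model_two_mul_of_divisor_of_w_eq_one (ht : 0 < t) {f d : ℤ}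
    (hw : Int.gcd (Int.gcd (2 * t / f) (2 * d / f) : ℤ) f = 1)
    (hex : ∃ r r' : ((Fin m → Fin 8 → ℤ) × ((Fin (n + 2) → ℤ) × (Fin (n + 2) → ℤ))) × ℤ,
      (((LinearMap.BilinForm.pi fun _ : Fin m ↦ -e8Form).prod (hyperbolicSum (n + 2))).prod
        ((-(2 * t : ℤ)) • LinearMap.mul ℤ ℤ)) r r = 2 * d ∧ r ≠ 0 ∧
      (∀ (k : ℤ) (w : ((Fin m → Fin 8 → ℤ) × ((Fin (n + 2) → ℤ) × (Fin (n + 2) → ℤ))) × ℤ), k ≠ 0 →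
        k • w ∈ ℤ ∙ r → w ∈ ℤ ∙ r) ∧
      (∀ z, f ∣ (((LinearMap.BilinForm.pi fun _ : Fin m ↦ -e8Form).prod (hyperbolicSum (n + 2))).prod
        ((-(2 * t : ℤ)) • LinearMap.mul ℤ ℤ)) r z) ∧
      (((LinearMap.BilinForm.pi fun _ : Fin m ↦ -e8Form).prod (hyperbolicSum (n + 2))).prod
        ((-(2 * t : ℤ)) • LinearMap.mul ℤ ℤ)) r r' = f) :
    Nat.card (Quot fun r s : {r : ((Fin m → Fin 8 → ℤ) × ((Fin (n + 2) → ℤ) × (Fin (n + 2) → ℤ))) × ℤ //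
        (((LinearMap.BilinForm.pi fun _ : Fin m ↦ -e8Form).prod (hyperbolicSum (n + 2))).prod
          ((-(2 * t : ℤ)) • LinearMap.mul ℤ ℤ)) r r = 2 * d ∧ r ≠ 0 ∧
        (∀ (k : ℤ) (w : ((Fin m → Fin 8 → ℤ) × ((Fin (n + 2) → ℤ) × (Fin (n + 2) → ℤ))) × ℤ), k ≠ 0 →
          k • w ∈ ℤ ∙ r → w ∈ ℤ ∙ r) ∧
        (∀ z, f ∣ (((LinearMap.BilinForm.pi fun _ : Fin m ↦ -e8Form).prod (hyperbolicSum (n + 2))).prod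
          ((-(2 * t : ℤ)) • LinearMap.mul ℤ ℤ)) r z) ∧
        ∃ r', (((LinearMap.BilinForm.pi fun _ : Fin m ↦ -e8Form).prod (hyperbolicSum (n + 2))).prod
          ((-(2 * t : ℤ)) • LinearMap.mul ℤ ℤ)) r r' = f} ↦
      ∃ g : ((((LinearMap.BilinForm.pi fun _ : Fin m ↦ -e8Form).prod (hyperbolicSum (n + 2))).prod
          ((-(2 * t : ℤ)) • LinearMap.mul ℤ ℤ))).IsometryEquiv
          ((((LinearMap.BilinForm.pi fun _ : Fin m ↦ -e8Form).prod (hyperbolicSum (n + 2))).prod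
          ((-(2 * t : ℤ)) • LinearMap.mul ℤ ℤ))), g r.1 = s.1) = 1 := by
  obtain ⟨-, heB, huB⟩ := isSymm_isEven_isUnimodular_pi_neg_e8Form_prod_hyperbolicSum' m (n + 2)
  exact natCard_quot_isometryEquiv_two_mul_of_divisor_of_w_eq_one t huB heB ht
    (twoHyperbolicPairs_pi_neg_e8Form_prod_hyperbolicSum_add_two m n) hw hex

end Model

/-! ### §8 The `O(L)`-orbits in general: the classes `c mod f` modulo `{σ mod 2t : σ² ≡ 1 (mod 4t)}` (row g44-#5) -/

section General

variable {M : Type u} [AddCommGroup M] [Module.Finite ℤ M] [Module.Free ℤ M] {B₀ : BilinForm ℤ M} (t : ℕ)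

/-- **The `O(L)`-orbit of `h_d`, as the proof of Cor. 4.7 computes it (no hypothesis on `w`)**: in `L = B₀ ⊕ ⟨−2t⟩` (`B₀` even
unimodular with two orthogonal hyperbolic pairs, `t ≥ 1`), two vectors `h, h'` with `h² = h'² = 2d` and
`(h, L) = (h', L) = fℤ` (`h ≠ 0`) lie in the same `O(L)`-orbit iff their `l_t`-coordinates satisfy `c' ≡ σc (mod f)` for some
`σ` with `σ² ≡ 1 (mod 4t)` — "all solutions `c mod f` … are equivalent modulo the action of this abelian `2`-group"
`O(D(L_{2t})) ≅ {x mod 2t ∣ x² ≡ 1 mod 4t}`, onto which `O(L_{2t})` maps (⟹: `ḡ = σ·` and §4; ⟸: §3 and Eichler's criterion).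
[cite: GritsenkoHulekSankaran2010Symplectic, §4 proof of Cor. 4.7 and Lemma 4.5] [cite: Nikulin1980, Thm. 1.14.2] [cite: GritsenkoHulekSankaran2009, Prop. 3.3 (i)] -/
theorem exists_isometryEquiv_apply_eq_iff_exists_sq_sub_one_dvd (hu : B₀.IsUnimodular) (he : B₀.IsEven) (ht : 0 < t)
    {x y x₁ y₁ : M} (h : TwoHyperbolicPairs B₀ x y x₁ y₁) {r s r' s' : M × ℤ} {f d : ℤ}
    (hr : B₀.prod ((-(2 * t : ℤ)) • LinearMap.mul ℤ ℤ) r r = 2 * d) (hr0 : r ≠ 0)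
    (hfr : ∀ z, f ∣ B₀.prod ((-(2 * t : ℤ)) • LinearMap.mul ℤ ℤ) r z) (hr' : B₀.prod ((-(2 * t : ℤ)) • LinearMap.mul ℤ ℤ) r r' = f)
    (hs : B₀.prod ((-(2 * t : ℤ)) • LinearMap.mul ℤ ℤ) s s = 2 * d)
    (hfs : ∀ z, f ∣ B₀.prod ((-(2 * t : ℤ)) • LinearMap.mul ℤ ℤ) s z) (hs' : B₀.prod ((-(2 * t : ℤ)) • LinearMap.mul ℤ ℤ) s s' = f) :
    (∃ g : (B₀.prod ((-(2 * t : ℤ)) • LinearMap.mul ℤ ℤ)).IsometryEquiv (B₀.prod ((-(2 * t : ℤ)) • LinearMap.mul ℤ ℤ)),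
      g r = s) ↔ ∃ σ : ℤ, (4 * t : ℤ) ∣ σ ^ 2 - 1 ∧ f ∣ σ * r.2 - s.2 := by
  have hf0 : f ≠ 0 := by
    rintro rfl
    exact hr0 ((nondegenerate_prod_neg_twoMul_smul_mul B₀ t hu ht).1 r fun z ↦ zero_dvd_iff.1 (hfr z))
  constructor
  · rintro ⟨g, hg⟩
    obtain ⟨σ, hσ, hσ'⟩ := exists_int_discriminantGroupCongr_eq_zsmul t hu h.isSymm he ht g
    refine ⟨σ, hσ, ?_⟩
    have h1 := dvd_snd_apply_sub_mul_snd_of_discriminantGroupCongr_eq_zsmul t hu ht g hσ' hf0 hfr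
    rw [hg] at h1
    have e : σ * r.2 - s.2 = -(s.2 - σ * r.2) := by ring
    rw [e]
    exact h1.neg_right
  · rintro ⟨σ, hσ, hσc⟩
    obtain ⟨g₁, hg₁⟩ := exists_isometryEquiv_discriminantGroupCongr_eq_zsmul t hu he ht h hσ
    have hdvd : f ∣ (g₁ r).2 - σ * r.2 := dvd_snd_apply_sub_mul_snd_of_discriminantGroupCongr_eq_zsmul t hu ht g₁ hg₁ hf0 hfr
    have hst : f ∣ (g₁ r).2 - s.2 := by
      have e : (g₁ r).2 - s.2 = ((g₁ r).2 - σ * r.2) + (σ * r.2 - s.2) := by ring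
      rw [e]
      exact dvd_add hdvd hσc
    have hg₁r : B₀.prod ((-(2 * t : ℤ)) • LinearMap.mul ℤ ℤ) (g₁ r) (g₁ r) = B₀.prod ((-(2 * t : ℤ)) • LinearMap.mul ℤ ℤ) s s := by
      rw [g₁.map_app, hr, hs]
    have hfg₁r : ∀ z, f ∣ B₀.prod ((-(2 * t : ℤ)) • LinearMap.mul ℤ ℤ) (g₁ r) z :=
      (forall_dvd_apply_iff_of_isometryEquiv g₁ r f).2 hfr
    have hg₁r' : B₀.prod ((-(2 * t : ℤ)) • LinearMap.mul ℤ ℤ) (g₁ r) (g₁ r') = f := by rw [g₁.map_app, hr']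
    obtain ⟨g₂, -, hg₂⟩ := (exists_stable_isometryEquiv_apply_eq_iff_dvd_snd_sub_snd t hu he ht h hf0 hg₁r hfg₁r hfs
      hg₁r' hs').2 hst
    exact ⟨g₁.trans g₂, by change g₂ (g₁ r) = s; exact hg₂⟩

/-- **The number of `O(L)`-orbits of primitive `h ∈ B₀ ⊕ ⟨−2t⟩` with `h² = 2d`, `(h, L) = fℤ` (`f ≥ 1`, `f ∣ 2t`) is the
number of admissible classes `{c mod f : (c, f) = 1, f² ∣ d + c²t}` modulo the action `c ↦ σc` of
`{σ : σ² ≡ 1 (mod 4t)}`** — the `Õ(L)`-count of Prop. 4.6 (`natCard_quot_stable_isometryEquiv_two_mul_of_divisor`) divided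
out by the image of `O(L)` in `O(D(L_{2t})) ≅ {x mod 2t ∣ x² ≡ 1 mod 4t}`; for `w = 1` this quotient is a point (Cor. 4.7).
`B₀` even unimodular with two orthogonal hyperbolic pairs, `t ≥ 1`.
[cite: GritsenkoHulekSankaran2010Symplectic, §4 proof of Cor. 4.7 and Prop. 4.6] [cite: Nikulin1980, Thm. 1.14.2] -/
theorem natCard_quot_isometryEquiv_two_mul_of_divisor (hu : B₀.IsUnimodular) (he : B₀.IsEven) (ht : 0 < t)
    {x y x₁ y₁ : M} (h : TwoHyperbolicPairs B₀ x y x₁ y₁) (d : ℤ) {f : ℕ} (hf0 : 0 < f) (hf : (f : ℤ) ∣ 2 * t) :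
    Nat.card (Quot fun r s : {r : M × ℤ // B₀.prod ((-(2 * t : ℤ)) • LinearMap.mul ℤ ℤ) r r = 2 * d ∧ r ≠ 0 ∧
        (∀ (k : ℤ) (w : M × ℤ), k ≠ 0 → k • w ∈ ℤ ∙ r → w ∈ ℤ ∙ r) ∧
        (∀ z, (f : ℤ) ∣ B₀.prod ((-(2 * t : ℤ)) • LinearMap.mul ℤ ℤ) r z) ∧
        ∃ r', B₀.prod ((-(2 * t : ℤ)) • LinearMap.mul ℤ ℤ) r r' = f} ↦
      ∃ g : (B₀.prod ((-(2 * t : ℤ)) • LinearMap.mul ℤ ℤ)).IsometryEquiv (B₀.prod ((-(2 * t : ℤ)) • LinearMap.mul ℤ ℤ)),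
        g r.1 = s.1) =
      Nat.card (Quot fun c c' : {c : ZMod f // IsUnit c ∧ (f : ℤ) ^ 2 ∣ d + t * (c.val : ℤ) ^ 2} ↦
        ∃ σ : ℤ, (4 * t : ℤ) ∣ σ ^ 2 - 1 ∧ (c'.1 : ZMod f) = (σ : ZMod f) * c.1) := by
  haveI : NeZero f := ⟨by omega⟩
  haveI : Module.IsTorsionFree ℤ M := inferInstance
  -- the invariant `c mod f`
  let F : {r : M × ℤ // B₀.prod ((-(2 * t : ℤ)) • LinearMap.mul ℤ ℤ) r r = 2 * d ∧ r ≠ 0 ∧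
        (∀ (k : ℤ) (w : M × ℤ), k ≠ 0 → k • w ∈ ℤ ∙ r → w ∈ ℤ ∙ r) ∧
        (∀ z, (f : ℤ) ∣ B₀.prod ((-(2 * t : ℤ)) • LinearMap.mul ℤ ℤ) r z) ∧
        ∃ r', B₀.prod ((-(2 * t : ℤ)) • LinearMap.mul ℤ ℤ) r r' = f} →
      {c : ZMod f // IsUnit c ∧ (f : ℤ) ^ 2 ∣ d + t * (c.val : ℤ) ^ 2} :=
    fun r ↦ ⟨(r.1.2 : ZMod f),
      (ZMod.coe_int_isUnit_iff_isCoprime _ _).2 (Int.isCoprime_iff_gcd_eq_one.2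
        (gcd_snd_eq_one_of_primitive_of_forall_dvd t hu r.2.2.1 r.2.2.2.1 r.2.2.2.2.1)),
      (sq_dvd_add_mul_val_sq_iff t hf0 hf _ d).2 (sq_dvd_add_mul_snd_sq_of_forall_dvd t hu he r.2.1 r.2.2.2.2.1)⟩
  have hF : ∀ r, ((F r).1 : ZMod f) = (r.1.2 : ZMod f) := fun r ↦ rfl
  -- `O(L)`-equivalence of vectors is the relation on the invariants
  have key : ∀ r s : {r : M × ℤ // B₀.prod ((-(2 * t : ℤ)) • LinearMap.mul ℤ ℤ) r r = 2 * d ∧ r ≠ 0 ∧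
        (∀ (k : ℤ) (w : M × ℤ), k ≠ 0 → k • w ∈ ℤ ∙ r → w ∈ ℤ ∙ r) ∧
        (∀ z, (f : ℤ) ∣ B₀.prod ((-(2 * t : ℤ)) • LinearMap.mul ℤ ℤ) r z) ∧
        ∃ r', B₀.prod ((-(2 * t : ℤ)) • LinearMap.mul ℤ ℤ) r r' = f},
      (∃ g : (B₀.prod ((-(2 * t : ℤ)) • LinearMap.mul ℤ ℤ)).IsometryEquiv (B₀.prod ((-(2 * t : ℤ)) • LinearMap.mul ℤ ℤ)),
        g r.1 = s.1) ↔ ∃ σ : ℤ, (4 * t : ℤ) ∣ σ ^ 2 - 1 ∧ ((F s).1 : ZMod f) = (σ : ZMod f) * (F r).1 := by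
    rintro ⟨r, hr, hr0, hrsat, hfr, r', hr'⟩ ⟨s, hs, hs0, hssat, hfs, s', hs'⟩
    rw [exists_isometryEquiv_apply_eq_iff_exists_sq_sub_one_dvd t hu he ht h hr hr0 hfr hr' hs hfs hs']
    refine exists_congr fun σ ↦ and_congr_right fun _ ↦ ?_
    rw [hF, hF]
    change _ ↔ (s.2 : ZMod f) = (σ : ZMod f) * (r.2 : ZMod f)
    rw [← Int.cast_mul, ZMod.intCast_eq_intCast_iff_dvd_sub]
  -- the induced map on classes is a bijection
  refine Nat.card_congr (Equiv.ofBijective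
    (Quot.lift (fun r ↦ Quot.mk _ (F r)) fun r s hrs ↦ Quot.sound ((key r s).1 hrs)) ⟨?_, ?_⟩)
  · rintro ⟨r⟩ ⟨s⟩ hrs
    have hrs' : Quot.mk (fun c c' : {c : ZMod f // IsUnit c ∧ (f : ℤ) ^ 2 ∣ d + t * (c.val : ℤ) ^ 2} ↦
        ∃ σ : ℤ, (4 * t : ℤ) ∣ σ ^ 2 - 1 ∧ (c'.1 : ZMod f) = (σ : ZMod f) * c.1) (F r) = Quot.mk _ (F s) := hrs
    -- equal classes of `F r`, `F s`: use the equivalence-closure description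
    have hrel : Relation.EqvGen (fun c c' : {c : ZMod f // IsUnit c ∧ (f : ℤ) ^ 2 ∣ d + t * (c.val : ℤ) ^ 2} ↦
        ∃ σ : ℤ, (4 * t : ℤ) ∣ σ ^ 2 - 1 ∧ (c'.1 : ZMod f) = (σ : ZMod f) * c.1) (F r) (F s) :=
      (Quot.eqvGen_exact hrs')
    -- the relation is already an equivalence relation on admissible classes (the `σ` form a group mod `2t`), so
    -- `EqvGen` collapses; we prove this by induction
    have hequiv : ∀ a b : {c : ZMod f // IsUnit c ∧ (f : ℤ) ^ 2 ∣ d + t * (c.val : ℤ) ^ 2},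
        Relation.EqvGen (fun c c' : {c : ZMod f // IsUnit c ∧ (f : ℤ) ^ 2 ∣ d + t * (c.val : ℤ) ^ 2} ↦
          ∃ σ : ℤ, (4 * t : ℤ) ∣ σ ^ 2 - 1 ∧ (c'.1 : ZMod f) = (σ : ZMod f) * c.1) a b →
        ∃ σ : ℤ, (4 * t : ℤ) ∣ σ ^ 2 - 1 ∧ (b.1 : ZMod f) = (σ : ZMod f) * a.1 := by
      intro a b hab
      induction hab with
      | rel a b hab => exact hab
      | refl a => exact ⟨1, by simp, by simp⟩
      | symm a b _ ih =>
        obtain ⟨σ, hσ, hab⟩ := ih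
        -- `σ·σ ≡ 1 (mod 2t)`, `f ∣ 2t`: `a = σ (σ a) = σ b`
        refine ⟨σ, hσ, ?_⟩
        have h2t : (f : ℤ) ∣ σ * σ - 1 := by
          have h1 : (2 * t : ℤ) ∣ σ * σ - 1 := by
            rw [← sq]
            exact (Dvd.intro 2 (by ring)).trans hσ
          exact hf.trans h1
        have hσσ : ((σ * σ : ℤ) : ZMod f) = ((1 : ℤ) : ZMod f) :=
          ((ZMod.intCast_eq_intCast_iff_dvd_sub _ _ f).2 h2t).symm
        rw [hab, ← mul_assoc, ← Int.cast_mul, hσσ, Int.cast_one, one_mul]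
      | trans a b c _ _ ih₁ ih₂ =>
        obtain ⟨σ₁, hσ₁, hab⟩ := ih₁
        obtain ⟨σ₂, hσ₂, hbc⟩ := ih₂
        refine ⟨σ₂ * σ₁, ?_, ?_⟩
        · have e : (σ₂ * σ₁) ^ 2 - 1 = σ₂ ^ 2 * (σ₁ ^ 2 - 1) + (σ₂ ^ 2 - 1) := by ring
          rw [e]
          exact dvd_add (hσ₁.mul_left _) hσ₂
        · rw [hbc, hab, ← mul_assoc, Int.cast_mul]
    exact Quot.sound ((key r s).2 (hequiv _ _ hrel))
  · rintro ⟨cc, hcu, hcc⟩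
    have hg : Int.gcd f (cc.val : ℤ) = 1 := by
      rw [Int.gcd_natCast_natCast]
      have h1 : IsUnit ((cc.val : ℕ) : ZMod f) := by rw [ZMod.natCast_zmod_val]; exact hcu
      exact Nat.Coprime.symm ((ZMod.isUnit_iff_coprime _ _).1 h1)
    obtain ⟨r, r', hrc, hr, hr0, hsat, hfr, hr'⟩ := (exists_primitive_apply_self_eq_snd_eq_iff t hu he h (f : ℤ) d
      (cc.val : ℤ)).2 ⟨hg, Dvd.dvd.mul_right hf _, hcc⟩
    refine ⟨Quot.mk _ ⟨r, hr, hr0, hsat, hfr, r', hr'⟩, ?_⟩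
    change Quot.mk _ (F ⟨r, hr, hr0, hsat, hfr, r', hr'⟩) = Quot.mk _ ⟨cc, hcu, hcc⟩
    congr 1
    refine Subtype.ext ?_
    change (r.2 : ZMod f) = cc
    rw [hrc, Int.cast_natCast, ZMod.natCast_zmod_val]

end General

section ModelGeneral

variable (m n t : ℕ)

/-- **The number of `O(L)`-orbits for the models** `(E₈(−1)^{⊕m} ⊕ U^{⊕(n+2)}) ⊕ ℤ(−2t)` (`t ≥ 1`, `f ≥ 1`, `f ∣ 2t`): the
admissible classes `c mod f` modulo `{σ : σ² ≡ 1 (mod 4t)}`. [cite: GritsenkoHulekSankaran2010Symplectic, §4 proof of Cor. 4.7 and Prop. 4.6] -/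
theorem natCard_quot_isometryEquiv_model_two_mul_of_divisor (ht : 0 < t) (d : ℤ) {f : ℕ} (hf0 : 0 < f)
    (hf : (f : ℤ) ∣ 2 * t) :
    Nat.card (Quot fun r s : {r : ((Fin m → Fin 8 → ℤ) × ((Fin (n + 2) → ℤ) × (Fin (n + 2) → ℤ))) × ℤ //
        (((LinearMap.BilinForm.pi fun _ : Fin m ↦ -e8Form).prod (hyperbolicSum (n + 2))).prod
          ((-(2 * t : ℤ)) • LinearMap.mul ℤ ℤ)) r r = 2 * d ∧ r ≠ 0 ∧
        (∀ (k : ℤ) (w : ((Fin m → Fin 8 → ℤ) × ((Fin (n + 2) → ℤ) × (Fin (n + 2) → ℤ))) × ℤ), k ≠ 0 →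
          k • w ∈ ℤ ∙ r → w ∈ ℤ ∙ r) ∧
        (∀ z, (f : ℤ) ∣ (((LinearMap.BilinForm.pi fun _ : Fin m ↦ -e8Form).prod (hyperbolicSum (n + 2))).prod
          ((-(2 * t : ℤ)) • LinearMap.mul ℤ ℤ)) r z) ∧
        ∃ r', (((LinearMap.BilinForm.pi fun _ : Fin m ↦ -e8Form).prod (hyperbolicSum (n + 2))).prod
          ((-(2 * t : ℤ)) • LinearMap.mul ℤ ℤ)) r r' = f} ↦
      ∃ g : ((((LinearMap.BilinForm.pi fun _ : Fin m ↦ -e8Form).prod (hyperbolicSum (n + 2))).prod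
          ((-(2 * t : ℤ)) • LinearMap.mul ℤ ℤ))).IsometryEquiv
          ((((LinearMap.BilinForm.pi fun _ : Fin m ↦ -e8Form).prod (hyperbolicSum (n + 2))).prod
          ((-(2 * t : ℤ)) • LinearMap.mul ℤ ℤ))), g r.1 = s.1) =
      Nat.card (Quot fun c c' : {c : ZMod f // IsUnit c ∧ (f : ℤ) ^ 2 ∣ d + t * (c.val : ℤ) ^ 2} ↦
        ∃ σ : ℤ, (4 * t : ℤ) ∣ σ ^ 2 - 1 ∧ (c'.1 : ZMod f) = (σ : ZMod f) * c.1) := by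
  obtain ⟨-, heB, huB⟩ := isSymm_isEven_isUnimodular_pi_neg_e8Form_prod_hyperbolicSum' m (n + 2)
  exact natCard_quot_isometryEquiv_two_mul_of_divisor t huB heB ht
    (twoHyperbolicPairs_pi_neg_e8Form_prod_hyperbolicSum_add_two m n) d hf0 hf

end ModelGeneral

/-! ### §9 The orbits of `{g ∈ O(L) : ḡ = ±id}`: the classes `c mod f` up to sign (row g45-#10)

Markman's second characterisation of the monodromy group of a manifold of `K3^{[n]}`-type (survey, Lemma 9.2 =
[Markman 2010, Lemma 4.2]): "`Mon²(X)` is equal to the inverse image via `π : O⁺(Λ) → O(Λ^*/Λ)` of the subgroup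
`{1, −1} ⊂ O(Λ^*/Λ)`", `Λ = Λ_{K3} ⊕ ⟨2 − 2n⟩ = L_{2(n−1)}`. The tree has no orientation character `O⁺`, so this section is
about the LARGER group `{g ∈ O(L) : ḡ = id or ḡ = −id} ⊇ Mon²` acting on the polarisation vectors of `L = B₀ ⊕ ⟨−2t⟩`
(`B₀` even unimodular with two orthogonal hyperbolic pairs): its orbits are the classes `c mod f` UP TO SIGN, by the method
of the proof of Cor. 4.7 — `ḡ = ±id` multiplies the `l_t`-coordinate by `±1` modulo the divisor (§4); conversely Eichler's
criterion (`ḡ = id`, Lemma 4.5) composed with one isometry inducing `−id` (§3). -/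

section Sign

variable {M : Type u} [AddCommGroup M] [Module.Finite ℤ M] [Module.Free ℤ M] {B₀ : BilinForm ℤ M} (t : ℕ)

/-- **Orbits of `{g ∈ O(L) : ḡ = ±id}`**: in `L = B₀ ⊕ ⟨−2t⟩` (`B₀` even unimodular with two orthogonal hyperbolic pairs,
`t ≥ 1`), for `h, h₁` with `h² = h₁² = 2d`, `(h, L) = (h₁, L) = fℤ` (`h ≠ 0`) there is an isometry `g` with `g h = h₁` inducing
`id` or `−id` on `A_L` iff the `l_t`-coordinates satisfy `c₁ ≡ c (mod f)` or `c₁ ≡ −c (mod f)` (the case `σ = ±1` of §8, with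
the acting isometry pinned down: `ḡ = id` is Eichler's criterion, `ḡ = −id` is §3's lift of `−1` followed by Eichler).
[cite: GritsenkoHulekSankaran2010Symplectic, §4 Lemma 4.5 and proof of Cor. 4.7] [cite: Markman2011Survey, §9.1.1 Lemma 9.2] [cite: GritsenkoHulekSankaran2009, Prop. 3.3 (i)] -/
theorem exists_isometryEquiv_apply_eq_iff_dvd_sub_or_dvd_add (hu : B₀.IsUnimodular) (he : B₀.IsEven) (ht : 0 < t)
    {x y x₁ y₁ : M} (h : TwoHyperbolicPairs B₀ x y x₁ y₁) {r s r' s' : M × ℤ} {f d : ℤ}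
    (hr : B₀.prod ((-(2 * t : ℤ)) • LinearMap.mul ℤ ℤ) r r = 2 * d) (hr0 : r ≠ 0)
    (hfr : ∀ z, f ∣ B₀.prod ((-(2 * t : ℤ)) • LinearMap.mul ℤ ℤ) r z) (hr' : B₀.prod ((-(2 * t : ℤ)) • LinearMap.mul ℤ ℤ) r r' = f)
    (hs : B₀.prod ((-(2 * t : ℤ)) • LinearMap.mul ℤ ℤ) s s = 2 * d)
    (hfs : ∀ z, f ∣ B₀.prod ((-(2 * t : ℤ)) • LinearMap.mul ℤ ℤ) s z) (hs' : B₀.prod ((-(2 * t : ℤ)) • LinearMap.mul ℤ ℤ) s s' = f) :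
    (∃ g : (B₀.prod ((-(2 * t : ℤ)) • LinearMap.mul ℤ ℤ)).IsometryEquiv (B₀.prod ((-(2 * t : ℤ)) • LinearMap.mul ℤ ℤ)),
      ((∀ a, g.discriminantGroupCongr a = a) ∨ (∀ a, g.discriminantGroupCongr a = -a)) ∧ g r = s) ↔
      f ∣ r.2 - s.2 ∨ f ∣ r.2 + s.2 := by
  have hf0 : f ≠ 0 := by
    rintro rfl
    exact hr0 ((nondegenerate_prod_neg_twoMul_smul_mul B₀ t hu ht).1 r fun z ↦ zero_dvd_iff.1 (hfr z))
  constructor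
  · rintro ⟨g, hg | hg, hgr⟩
    · have h1 := dvd_snd_apply_sub_mul_snd_of_discriminantGroupCongr_eq_zsmul t hu ht g (s := 1)
        (fun a ↦ by rw [hg a, one_smul]) hf0 hfr
      rw [hgr, one_mul] at h1
      have e : r.2 - s.2 = -(s.2 - r.2) := by ring
      exact Or.inl (by rw [e]; exact h1.neg_right)
    · have h1 := dvd_snd_apply_sub_mul_snd_of_discriminantGroupCongr_eq_zsmul t hu ht g (s := -1)
        (fun a ↦ by rw [hg a, neg_one_smul]) hf0 hfr
      rw [hgr] at h1
      have e : r.2 + s.2 = s.2 - -1 * r.2 := by ring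
      exact Or.inr (by rw [e]; exact h1)
  · rintro (h1 | h1)
    · obtain ⟨g, hg, hgr⟩ := (exists_stable_isometryEquiv_apply_eq_iff_dvd_snd_sub_snd t hu he ht h hf0 (hr.trans hs.symm)
        hfr hfs hr' hs').2 h1
      exact ⟨g, Or.inl fun a ↦ by rw [hg]; rfl, hgr⟩
    · obtain ⟨g₁, hg₁⟩ := exists_isometryEquiv_discriminantGroupCongr_eq_zsmul t hu he ht h (s := -1) (by norm_num)
      have hdvd : f ∣ (g₁ r).2 - -1 * r.2 :=
        dvd_snd_apply_sub_mul_snd_of_discriminantGroupCongr_eq_zsmul t hu ht g₁ hg₁ hf0 hfr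
      have hst : f ∣ (g₁ r).2 - s.2 := by
        have e : (g₁ r).2 - s.2 = ((g₁ r).2 - -1 * r.2) - (r.2 + s.2) := by ring
        rw [e]
        exact dvd_sub hdvd h1
      have hg₁r : B₀.prod ((-(2 * t : ℤ)) • LinearMap.mul ℤ ℤ) (g₁ r) (g₁ r) = B₀.prod ((-(2 * t : ℤ)) • LinearMap.mul ℤ ℤ) s s := by
        rw [g₁.map_app, hr, hs]
      have hfg₁r : ∀ z, f ∣ B₀.prod ((-(2 * t : ℤ)) • LinearMap.mul ℤ ℤ) (g₁ r) z :=
        (forall_dvd_apply_iff_of_isometryEquiv g₁ r f).2 hfr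
      have hg₁r' : B₀.prod ((-(2 * t : ℤ)) • LinearMap.mul ℤ ℤ) (g₁ r) (g₁ r') = f := by rw [g₁.map_app, hr']
      obtain ⟨g₂, hg₂, hg₂r⟩ := (exists_stable_isometryEquiv_apply_eq_iff_dvd_snd_sub_snd t hu he ht h hf0 hg₁r hfg₁r hfs
        hg₁r' hs').2 hst
      refine ⟨g₁.trans g₂, Or.inr fun a ↦ ?_, by change g₂ (g₁ r) = s; exact hg₂r⟩
      rw [LinearMap.BilinForm.IsometryEquiv.discriminantGroupCongr_trans, LinearEquiv.trans_apply, hg₁, hg₂, map_smul,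
        LinearEquiv.refl_apply, neg_one_smul]

/-- **The number of `{g ∈ O(L) : ḡ = ±id}`-orbits of primitive `h ∈ B₀ ⊕ ⟨−2t⟩` with `h² = 2d`, `(h, L) = fℤ`** (`f ≥ 1`,
`f ∣ 2t`) is the number of admissible classes `{c mod f : (c, f) = 1, f² ∣ d + c²t}` (the `Õ(L)`-orbits, Prop. 4.6) up to
sign `c ∼ −c`. For `L_{2(n−1)} = Λ(K3^{[n]})` the group `π⁻¹{±1} ∩ O⁺` is `Mon²` (Markman); the count here is for `π⁻¹{±1}`.
[cite: GritsenkoHulekSankaran2010Symplectic, §4 Prop. 4.6 and proof of Cor. 4.7] [cite: Markman2011Survey, §9.1.1 Lemma 9.2] -/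
theorem natCard_quot_isometryEquiv_discriminantGroupCongr_eq_self_or_neg_two_mul_of_divisor (hu : B₀.IsUnimodular)
    (he : B₀.IsEven) (ht : 0 < t) {x y x₁ y₁ : M} (h : TwoHyperbolicPairs B₀ x y x₁ y₁) (d : ℤ) {f : ℕ} (hf0 : 0 < f)
    (hf : (f : ℤ) ∣ 2 * t) :
    Nat.card (Quot fun r s : {r : M × ℤ // B₀.prod ((-(2 * t : ℤ)) • LinearMap.mul ℤ ℤ) r r = 2 * d ∧ r ≠ 0 ∧
        (∀ (k : ℤ) (w : M × ℤ), k ≠ 0 → k • w ∈ ℤ ∙ r → w ∈ ℤ ∙ r) ∧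
        (∀ z, (f : ℤ) ∣ B₀.prod ((-(2 * t : ℤ)) • LinearMap.mul ℤ ℤ) r z) ∧
        ∃ r', B₀.prod ((-(2 * t : ℤ)) • LinearMap.mul ℤ ℤ) r r' = f} ↦
      ∃ g : (B₀.prod ((-(2 * t : ℤ)) • LinearMap.mul ℤ ℤ)).IsometryEquiv (B₀.prod ((-(2 * t : ℤ)) • LinearMap.mul ℤ ℤ)),
        ((∀ a, g.discriminantGroupCongr a = a) ∨ (∀ a, g.discriminantGroupCongr a = -a)) ∧ g r.1 = s.1) =
      Nat.card (Quot fun c c' : {c : ZMod f // IsUnit c ∧ (f : ℤ) ^ 2 ∣ d + t * (c.val : ℤ) ^ 2} ↦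
        (c'.1 : ZMod f) = c.1 ∨ (c'.1 : ZMod f) = -c.1) := by
  haveI : NeZero f := ⟨by omega⟩
  haveI : Module.IsTorsionFree ℤ M := inferInstance
  -- the invariant `c mod f`
  let F : {r : M × ℤ // B₀.prod ((-(2 * t : ℤ)) • LinearMap.mul ℤ ℤ) r r = 2 * d ∧ r ≠ 0 ∧
        (∀ (k : ℤ) (w : M × ℤ), k ≠ 0 → k • w ∈ ℤ ∙ r → w ∈ ℤ ∙ r) ∧
        (∀ z, (f : ℤ) ∣ B₀.prod ((-(2 * t : ℤ)) • LinearMap.mul ℤ ℤ) r z) ∧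
        ∃ r', B₀.prod ((-(2 * t : ℤ)) • LinearMap.mul ℤ ℤ) r r' = f} →
      {c : ZMod f // IsUnit c ∧ (f : ℤ) ^ 2 ∣ d + t * (c.val : ℤ) ^ 2} :=
    fun r ↦ ⟨(r.1.2 : ZMod f),
      (ZMod.coe_int_isUnit_iff_isCoprime _ _).2 (Int.isCoprime_iff_gcd_eq_one.2
        (gcd_snd_eq_one_of_primitive_of_forall_dvd t hu r.2.2.1 r.2.2.2.1 r.2.2.2.2.1)),
      (sq_dvd_add_mul_val_sq_iff t hf0 hf _ d).2 (sq_dvd_add_mul_snd_sq_of_forall_dvd t hu he r.2.1 r.2.2.2.2.1)⟩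
  have hF : ∀ r, ((F r).1 : ZMod f) = (r.1.2 : ZMod f) := fun r ↦ rfl
  -- equivalence of vectors under the group is the relation "equal up to sign" on the invariants
  have key : ∀ r s : {r : M × ℤ // B₀.prod ((-(2 * t : ℤ)) • LinearMap.mul ℤ ℤ) r r = 2 * d ∧ r ≠ 0 ∧
        (∀ (k : ℤ) (w : M × ℤ), k ≠ 0 → k • w ∈ ℤ ∙ r → w ∈ ℤ ∙ r) ∧
        (∀ z, (f : ℤ) ∣ B₀.prod ((-(2 * t : ℤ)) • LinearMap.mul ℤ ℤ) r z) ∧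
        ∃ r', B₀.prod ((-(2 * t : ℤ)) • LinearMap.mul ℤ ℤ) r r' = f},
      (∃ g : (B₀.prod ((-(2 * t : ℤ)) • LinearMap.mul ℤ ℤ)).IsometryEquiv (B₀.prod ((-(2 * t : ℤ)) • LinearMap.mul ℤ ℤ)),
        ((∀ a, g.discriminantGroupCongr a = a) ∨ (∀ a, g.discriminantGroupCongr a = -a)) ∧ g r.1 = s.1) ↔
        ((F s).1 : ZMod f) = (F r).1 ∨ ((F s).1 : ZMod f) = -(F r).1 := by
    rintro ⟨r, hr, hr0, hrsat, hfr, r', hr'⟩ ⟨s, hs, hs0, hssat, hfs, s', hs'⟩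
    rw [exists_isometryEquiv_apply_eq_iff_dvd_sub_or_dvd_add t hu he ht h hr hr0 hfr hr' hs hfs hs', hF, hF]
    change _ ↔ (s.2 : ZMod f) = (r.2 : ZMod f) ∨ (s.2 : ZMod f) = -(r.2 : ZMod f)
    rw [ZMod.intCast_eq_intCast_iff_dvd_sub, eq_neg_iff_add_eq_zero, ← Int.cast_add, ZMod.intCast_zmod_eq_zero_iff_dvd,
      add_comm]
  -- the induced map on classes is a bijection
  refine Nat.card_congr (Equiv.ofBijective
    (Quot.lift (fun r ↦ Quot.mk _ (F r)) fun r s hrs ↦ Quot.sound ((key r s).1 hrs)) ⟨?_, ?_⟩)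
  · rintro ⟨r⟩ ⟨s⟩ hrs
    have hrs' : Quot.mk (fun c c' : {c : ZMod f // IsUnit c ∧ (f : ℤ) ^ 2 ∣ d + t * (c.val : ℤ) ^ 2} ↦
        (c'.1 : ZMod f) = c.1 ∨ (c'.1 : ZMod f) = -c.1) (F r) = Quot.mk _ (F s) := hrs
    have hrel : Relation.EqvGen (fun c c' : {c : ZMod f // IsUnit c ∧ (f : ℤ) ^ 2 ∣ d + t * (c.val : ℤ) ^ 2} ↦
        (c'.1 : ZMod f) = c.1 ∨ (c'.1 : ZMod f) = -c.1) (F r) (F s) :=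
      Quot.eqvGen_exact hrs'
    -- "equal up to sign" is already an equivalence relation, so `EqvGen` collapses
    have hequiv : ∀ a b : {c : ZMod f // IsUnit c ∧ (f : ℤ) ^ 2 ∣ d + t * (c.val : ℤ) ^ 2},
        Relation.EqvGen (fun c c' : {c : ZMod f // IsUnit c ∧ (f : ℤ) ^ 2 ∣ d + t * (c.val : ℤ) ^ 2} ↦
          (c'.1 : ZMod f) = c.1 ∨ (c'.1 : ZMod f) = -c.1) a b →
        (b.1 : ZMod f) = a.1 ∨ (b.1 : ZMod f) = -a.1 := by
      intro a b hab
      induction hab with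
      | rel a b hab => exact hab
      | refl a => exact Or.inl rfl
      | symm a b _ ih =>
        rcases ih with ih | ih
        · exact Or.inl ih.symm
        · exact Or.inr (by rw [ih, neg_neg])
      | trans a b c _ _ ih₁ ih₂ =>
        rcases ih₁ with h₁ | h₁ <;> rcases ih₂ with h₂ | h₂
        · exact Or.inl (h₂.trans h₁)
        · exact Or.inr (by rw [h₂, h₁])
        · exact Or.inr (by rw [h₂, h₁])
        · exact Or.inl (by rw [h₂, h₁, neg_neg])
    exact Quot.sound ((key r s).2 (hequiv _ _ hrel))
  · rintro ⟨cc, hcu, hcc⟩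
    have hg : Int.gcd f (cc.val : ℤ) = 1 := by
      rw [Int.gcd_natCast_natCast]
      have h1 : IsUnit ((cc.val : ℕ) : ZMod f) := by rw [ZMod.natCast_zmod_val]; exact hcu
      exact Nat.Coprime.symm ((ZMod.isUnit_iff_coprime _ _).1 h1)
    obtain ⟨r, r', hrc, hr, hr0, hsat, hfr, hr'⟩ := (exists_primitive_apply_self_eq_snd_eq_iff t hu he h (f : ℤ) d
      (cc.val : ℤ)).2 ⟨hg, Dvd.dvd.mul_right hf _, hcc⟩
    refine ⟨Quot.mk _ ⟨r, hr, hr0, hsat, hfr, r', hr'⟩, ?_⟩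
    change Quot.mk _ (F ⟨r, hr, hr0, hsat, hfr, r', hr'⟩) = Quot.mk _ ⟨cc, hcu, hcc⟩
    congr 1
    refine Subtype.ext ?_
    change (r.2 : ZMod f) = cc
    rw [hrc, Int.cast_natCast, ZMod.natCast_zmod_val]

end Sign

section ModelSign

variable (m n t : ℕ)

/-- **Orbits of `{g : ḡ = ±id}` for the models** `(E₈(−1)^{⊕m} ⊕ U^{⊕(n+2)}) ⊕ ℤ(−2t)` (`L_{2t}`: `m = 2`, `n = 1`): `h ∼ h₁` iff
`c₁ ≡ ±c (mod f)`. [cite: GritsenkoHulekSankaran2010Symplectic, §4 Lemma 4.5 and proof of Cor. 4.7] [cite: Markman2011Survey, §9.1.1 Lemma 9.2] -/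
theorem exists_isometryEquiv_model_apply_eq_iff_dvd_sub_or_dvd_add (ht : 0 < t)
    {r s r' s' : ((Fin m → Fin 8 → ℤ) × ((Fin (n + 2) → ℤ) × (Fin (n + 2) → ℤ))) × ℤ} {f d : ℤ}
    (hr : (((LinearMap.BilinForm.pi fun _ : Fin m ↦ -e8Form).prod (hyperbolicSum (n + 2))).prod
          ((-(2 * t : ℤ)) • LinearMap.mul ℤ ℤ)) r r = 2 * d) (hr0 : r ≠ 0)
    (hfr : ∀ z, f ∣ (((LinearMap.BilinForm.pi fun _ : Fin m ↦ -e8Form).prod (hyperbolicSum (n + 2))).prod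
          ((-(2 * t : ℤ)) • LinearMap.mul ℤ ℤ)) r z)
    (hr' : (((LinearMap.BilinForm.pi fun _ : Fin m ↦ -e8Form).prod (hyperbolicSum (n + 2))).prod
          ((-(2 * t : ℤ)) • LinearMap.mul ℤ ℤ)) r r' = f)
    (hs : (((LinearMap.BilinForm.pi fun _ : Fin m ↦ -e8Form).prod (hyperbolicSum (n + 2))).prod
          ((-(2 * t : ℤ)) • LinearMap.mul ℤ ℤ)) s s = 2 * d)
    (hfs : ∀ z, f ∣ (((LinearMap.BilinForm.pi fun _ : Fin m ↦ -e8Form).prod (hyperbolicSum (n + 2))).prod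
          ((-(2 * t : ℤ)) • LinearMap.mul ℤ ℤ)) s z)
    (hs' : (((LinearMap.BilinForm.pi fun _ : Fin m ↦ -e8Form).prod (hyperbolicSum (n + 2))).prod
          ((-(2 * t : ℤ)) • LinearMap.mul ℤ ℤ)) s s' = f) :
    (∃ g : ((((LinearMap.BilinForm.pi fun _ : Fin m ↦ -e8Form).prod (hyperbolicSum (n + 2))).prod
          ((-(2 * t : ℤ)) • LinearMap.mul ℤ ℤ))).IsometryEquiv
        ((((LinearMap.BilinForm.pi fun _ : Fin m ↦ -e8Form).prod (hyperbolicSum (n + 2))).prod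
          ((-(2 * t : ℤ)) • LinearMap.mul ℤ ℤ))),
      ((∀ a, g.discriminantGroupCongr a = a) ∨ (∀ a, g.discriminantGroupCongr a = -a)) ∧ g r = s) ↔
      f ∣ r.2 - s.2 ∨ f ∣ r.2 + s.2 := by
  obtain ⟨-, heB, huB⟩ := isSymm_isEven_isUnimodular_pi_neg_e8Form_prod_hyperbolicSum' m (n + 2)
  exact exists_isometryEquiv_apply_eq_iff_dvd_sub_or_dvd_add t huB heB ht
    (twoHyperbolicPairs_pi_neg_e8Form_prod_hyperbolicSum_add_two m n) hr hr0 hfr hr' hs hfs hs'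

/-- **The number of `{g : ḡ = ±id}`-orbits for the models**: the admissible classes `c mod f` up to sign.
[cite: GritsenkoHulekSankaran2010Symplectic, §4 Prop. 4.6 and proof of Cor. 4.7] [cite: Markman2011Survey, §9.1.1 Lemma 9.2] -/
theorem natCard_quot_isometryEquiv_discriminantGroupCongr_eq_self_or_neg_model_two_mul_of_divisor (ht : 0 < t) (d : ℤ)
    {f : ℕ} (hf0 : 0 < f) (hf : (f : ℤ) ∣ 2 * t) :
    Nat.card (Quot fun r s : {r : ((Fin m → Fin 8 → ℤ) × ((Fin (n + 2) → ℤ) × (Fin (n + 2) → ℤ))) × ℤ //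
        (((LinearMap.BilinForm.pi fun _ : Fin m ↦ -e8Form).prod (hyperbolicSum (n + 2))).prod
          ((-(2 * t : ℤ)) • LinearMap.mul ℤ ℤ)) r r = 2 * d ∧ r ≠ 0 ∧
        (∀ (k : ℤ) (w : ((Fin m → Fin 8 → ℤ) × ((Fin (n + 2) → ℤ) × (Fin (n + 2) → ℤ))) × ℤ), k ≠ 0 →
          k • w ∈ ℤ ∙ r → w ∈ ℤ ∙ r) ∧
        (∀ z, (f : ℤ) ∣ (((LinearMap.BilinForm.pi fun _ : Fin m ↦ -e8Form).prod (hyperbolicSum (n + 2))).prod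
          ((-(2 * t : ℤ)) • LinearMap.mul ℤ ℤ)) r z) ∧
        ∃ r', (((LinearMap.BilinForm.pi fun _ : Fin m ↦ -e8Form).prod (hyperbolicSum (n + 2))).prod
          ((-(2 * t : ℤ)) • LinearMap.mul ℤ ℤ)) r r' = f} ↦
      ∃ g : ((((LinearMap.BilinForm.pi fun _ : Fin m ↦ -e8Form).prod (hyperbolicSum (n + 2))).prod
          ((-(2 * t : ℤ)) • LinearMap.mul ℤ ℤ))).IsometryEquiv
          ((((LinearMap.BilinForm.pi fun _ : Fin m ↦ -e8Form).prod (hyperbolicSum (n + 2))).prod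
          ((-(2 * t : ℤ)) • LinearMap.mul ℤ ℤ))),
        ((∀ a, g.discriminantGroupCongr a = a) ∨ (∀ a, g.discriminantGroupCongr a = -a)) ∧ g r.1 = s.1) =
      Nat.card (Quot fun c c' : {c : ZMod f // IsUnit c ∧ (f : ℤ) ^ 2 ∣ d + t * (c.val : ℤ) ^ 2} ↦
        (c'.1 : ZMod f) = c.1 ∨ (c'.1 : ZMod f) = -c.1) := by
  obtain ⟨-, heB, huB⟩ := isSymm_isEven_isUnimodular_pi_neg_e8Form_prod_hyperbolicSum' m (n + 2)
  exact natCard_quot_isometryEquiv_discriminantGroupCongr_eq_self_or_neg_two_mul_of_divisor t huB heB ht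
    (twoHyperbolicPairs_pi_neg_e8Form_prod_hyperbolicSum_add_two m n) d hf0 hf

end ModelSign

end Literature.Topology.FourManifolds
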